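import Summits.CriticalPhenomena.SAWScalingLimit.Theses.SAWRenewalTightness
import Literature.Probability.RandomPlanarGeometry.SAWParafermion
import Literature.Probability.RandomPlanarGeometry.ConformalRestrictionProofs
import Literature.Probability.RandomPlanarGeometry.CaratheodoryHalfPlaneProofs
import Literature.Probability.RandomPlanarGeometry.LocalMartingaleProofs
import Literature.Probability.RandomPlanarGeometry.SAWSideProbability
import Literature.Probability.RandomPlanarGeometry.ChordalReversibility
import Literature.Probability.Percolation.LoopRotationInvarianceAssembly
import Summits.CriticalPhenomena.SAWScalingLimit.Theorems.ObservableToSLE.Negative.CompactContainer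
import Summits.CriticalPhenomena.SAWScalingLimit.Theses.SAWLaplacianWalk
import Literature.Probability.RandomPlanarGeometry.DrivingFunctionMeasurable

/-!
# Disproof of `SubseqIdentification` (crux stmt-CriticalPhenomena-0783) — findings

WORK FILE of the standing disprover (cdisprove seat). Target decl:
`Summit.CriticalPhenomena.SAWScalingLimit.Theses.SAWRenewalTightness.SubseqIdentification`
(identical body in `SAWParafermion`, `SAWLeftRightFKG`, `SAWAsymptoticMorera`, … — the ledger dedups):

  ∀ D a b, IsEndpointApprox D a b → ∀ s μ, s → 0⁺ → IsProbabilityMeasure μ →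
    (∀ f ∈ C_b(CurveClass ℂ), ∫ f∘curve dP^{SAW}_{D, s n, a(s n), b(s n)} → ∫ f dμ) → IsSLELaw (8/3) D μ.

VERDICT (cycle 1): NO KILL. The statement is honestly typed; every degenerate regime is excluded by a
hypothesis, and each such hypothesis is shown LOAD-BEARING below by an explicit witness (§1). A genuine
refutation would have to EXHIBIT an identified subsequential scaling limit of the critical `ℤ²` SAW in
some Jordan domain and show it is not chordal SLE_{8/3}; no such limit is identified in any domain
(open since Lawler–Schramm–Werner 2004), and the cheap necessary conditions of `IsSLELaw`
(endpoints `a`, `b`; support in `D̄`) are met by every subsequential limit (§3 records the mass lemma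
behind this). See §4 (docstring `resists`) for the full list of attacks and why each fails.

VERDICT (cycle 2): STILL NO KILL — and two precise DEBTS any proof must pay. §5: the critical SAW law
is EXACTLY reversible at every mesh (`x_c^{|γ|}` is reversal invariant), so subsequential limits of
`(D; b, a)` are time reversals of those of `(D; a, b)`, and the crux ALONE proves Zhan's reversibility
of chordal SLE_{8/3} on every Dobrushin domain carrying a subsequential SAW limit (law level, via the
in-tree uniqueness `IsSLELaw.unique'`); under the route's `EventualTight` that is every domain with an
endpoint approximation (Prokhorov past the junk meshes). §6: TIGHTNESS IS NECESSARY on `ℤ²`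
(`SAWScalingLimit → EventualTight`, fixed `δ₀`, compact containers of lattice polylines), hence
`SAWScalingLimit ↔ EventualTight ∧ SubseqIdentification`: the route's split is lossless and the crux
is precisely "the LSW conjecture minus tightness". §7: the two debts as sorried statements
(reversibility of SLE_{8/3}: true, not in tree; existence of ONE subsequential limit: open = tightness).
§6b (after the lead PICKED `room-entropy-wright-fisher`): its named hypothesis `LimitsDescribable`
(stmt-4481, KS-regularity of subsequential limits) is NECESSARY for the crux — SLE_κ laws are a.s.
Loewner-describable through EVERY chordal uniformizing map (dilation covariance) — so the line loses
nothing by assuming it. §8: `verdict_cycle2` + attack log items 8–12 (symmetries, κ-rigidity via restriction, non-vacuity,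
Kennedy–Lawler lattice effects and Kennedy's square-lattice Monte Carlo READ and cited, boundary
pathologies of `meshGraph`).

Contents
* §0 toolkit: the SAW law between COINCIDENT endpoints is a Dirac mass at the trivial walk, whose curve
  class is the constant class `constClass (δ·w)`; `¬ IsSLELaw κ D (dirac c)` as soon as `c` has a wrong
  endpoint (via the in-tree `IsSLELaw.ae_endpoints` + `mapsTo_boundaryExtension_holds`, both sorry-free).
* §0b toolkit: an HONEST endpoint approximation `(stdA, stdB)` of the unit disc `(𝔻; 1, -1)` (the disc's
  mesh graph is connected, so `Ω_δ = δℤ² ∩ 𝔻`), re-hosted from `Theorems/SAWParafermionTightRefutation`.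
* §1 LOAD-BEARING ANALYSIS of `IsEndpointApprox` (`…Without…` / `_false_without_…`, all sorry-free):
  - whole hypothesis dropped ⇒ FALSE; only `reachable` kept ⇒ FALSE (witness `a = b ≡ 0`): so
    `reachable` is NOT load-bearing (§3 even derives it along the sequence from the other hypotheses);
  - `tendsto_snd` alone dropped ⇒ FALSE (`a = b = stdA → 1`: limit `dirac (constClass 1)` ends at `1 ≠ b`);
  - `tendsto_fst` alone dropped ⇒ FALSE (mirror): EACH endpoint limit is load-bearing.
* §1c `IsProbabilityMeasure μ` is NOT load-bearing: the crux is EQUIVALENT to its version without it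
  (`subseqIdentification_iff_withoutProb`; the laws are eventually probability measures, re-hosting the
  finiteness argument of the route's `closes`).
* §2 LOAD-BEARING ANALYSIS of the mesh filter: two-sided `𝓝 0` ⇒ FALSE (negative meshes escape the
  endpoint hypothesis); positivity without `s → 0` ⇒ FALSE (fixed mesh `s ≡ 2`).
* §3 POSITIVE BY-PRODUCTS (prover briefing): `SAWScalingLimit → SubseqIdentification` (the crux is
  NECESSARY for the conjunct: a kill here kills the LSW conjecture as typed and every SAW route); mass of
  `SAW.law ∈ {0,1}`; the `f ≡ 1` test integral alone makes the laws eventually probability measures and the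
  endpoints eventually joined; every subsequential limit a.s. runs from `a` to `b` inside `D̄`
  (`ae_endpoints_of_hyps`, `ae_range_subset_closure_of_hyps`) — exactly the a.s. clauses of
  `IsSLELaw.ae_endpoints`, so endpoint/support-type obstructions never bite the crux.
* §4 `verdict_cycle1`: conjunction of the above with the docstring "WHY IT RESISTS" (attack log).
-/

noncomputable section

open Literature.Probability.RandomPlanarGeometry Literature.Probability.RandomPlanarGeometry.SAW
  Literature.Probability.LatticeModels Literature.Probability.Percolation Literature.Probability
  MeasureTheory Filter Topology Set
open scoped NNReal ENNReal BoundedContinuousFunction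

namespace Summit.CriticalPhenomena.SAWScalingLimit.Cruxes.SubseqIdentification.Disproof

/-! ## §0 Toolkit -/

/-- The origin of `ℤ²` sits at the origin of `ℂ` at every mesh. [folklore] -/
theorem meshPoint_zero (δ : ℝ) : meshPoint δ (0 : Site 2) = 0 :=
  Complex.ext (by simp) (by simp)

/-- The class of the constant curve at `z`. [folklore] -/
def constClass (z : ℂ) : CurveClass ℂ :=
  CurveClass.mk (Curve.const z)

/-- The constant class starts at its point. [folklore] -/
@[simp] theorem source_constClass (z : ℂ) : (constClass z).source = z := rfl

/-- The constant class ends at its point. [folklore] -/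
@[simp] theorem target_constClass (z : ℂ) : (constClass z).target = z := rfl

/-- The polyline of the trivial walk is the constant map. [folklore] -/
theorem toCurve_nil {G : SimpleGraph (Site 2)} (emb : Site 2 → ℂ) (w : Site 2) :
    (SimpleGraph.Walk.nil : G.Walk w w).toCurve emb = ContinuousMap.const _ (emb w) := by
  ext t
  rfl

/-- The curve class of the trivial SAW at `w` is the constant class at `δ·w`. [folklore] -/
theorem curve_nil (Ω : Set ℂ) (δ : ℝ) (w : Site 2) :
    (DomainSAW.nil w : DomainSAW Ω δ w w).curve = constClass (meshPoint δ w) := by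
  simp only [DomainSAW.curve, DomainSAW.nil, constClass, Curve.const, toCurve_nil]

/-- Between coincident endpoints the critical SAW measure is the Dirac mass at the trivial walk
(a closed self-avoiding walk is trivial, `DomainSAW.uniqueSelf`; its weight is `x_c^0 = 1`).
[folklore] -/
theorem weight_self (Ω : Set ℂ) (δ : ℝ) (w : Site 2) :
    weight Ω δ w w = Measure.dirac (DomainSAW.nil w) := by
  rw [weight, Measure.sum_fintype, Fintype.sum_unique]
  change ENNReal.ofReal (criticalFugacity ^ (DomainSAW.nil w : DomainSAW Ω δ w w).length) •
    Measure.dirac (DomainSAW.nil w) = _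
  simp

/-- Between coincident endpoints the critical SAW LAW is the Dirac mass at the trivial walk (no
normalisation issue: total weight `1`). [folklore] -/
theorem law_self (Ω : Set ℂ) (δ : ℝ) (w : Site 2) :
    law Ω δ w w = Measure.dirac (DomainSAW.nil w) := by
  rw [law, weight_self]
  simp

/-- Hence every test integral against the coincident-endpoint law is an evaluation at the
constant class. [folklore] -/
theorem integral_law_self (Ω : Set ℂ) (δ : ℝ) (w : Site 2) (f : CurveClass ℂ →ᵇ ℝ) :
    ∫ γ, f γ.curve ∂(law Ω δ w w) = f (constClass (meshPoint δ w)) := by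
  rw [law_self, integral_dirac' _ _
    ((DomainSAW.measurable_of_top fun γ : DomainSAW Ω δ w w => f γ.curve).stronglyMeasurable),
    curve_nil]

/-- The marked points of the unit-disc Dobrushin domain: `a = 1`. [folklore] -/
theorem unitDisc_pt_zero : DobrushinDomain.unitDisc.pt 0 = 1 := by
  simp [MarkedDomain.pt, DobrushinDomain.unitDisc, JordanDomain.unitDisc, circleMap]

/-- The marked points of the unit-disc Dobrushin domain: `b = -1`. [folklore] -/
theorem unitDisc_pt_one : DobrushinDomain.unitDisc.pt 1 = -1 := by
  simp [MarkedDomain.pt, DobrushinDomain.unitDisc, JordanDomain.unitDisc, circleMap]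
  rw [show (2 * (Real.pi : ℂ) * 2⁻¹ * Complex.I) = Real.pi * Complex.I by ring]
  exact Complex.exp_pi_mul_I

/-- A Dirac mass at a class with the wrong STARTING point is not a chordal SLE law of `(D; a, b)`
(SLE curves start at `a` a.s.: in-tree `IsSLELaw.ae_endpoints`, Carathéodory input
`JordanDomain.mapsTo_boundaryExtension_holds`, both sorry-free). [folklore] -/
theorem not_isSLELaw_dirac_of_source_ne {κ : ℝ≥0} {D : DobrushinDomain} {c : CurveClass ℂ}
    (hc : c.source ≠ D.pt 0) : ¬ IsSLELaw κ D (Measure.dirac c) := by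
  intro h
  have h1 := IsSLELaw.ae_endpoints JordanDomain.mapsTo_boundaryExtension_holds h
  rw [ae_dirac_eq] at h1
  exact hc (Filter.eventually_pure.1 h1).1

/-- A Dirac mass at a class with the wrong END point is not a chordal SLE law of `(D; a, b)`.
[folklore] -/
theorem not_isSLELaw_dirac_of_target_ne {κ : ℝ≥0} {D : DobrushinDomain} {c : CurveClass ℂ}
    (hc : c.target ≠ D.pt 1) : ¬ IsSLELaw κ D (Measure.dirac c) := by
  intro h
  have h1 := IsSLELaw.ae_endpoints JordanDomain.mapsTo_boundaryExtension_holds h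
  rw [ae_dirac_eq] at h1
  exact hc (Filter.eventually_pure.1 h1).2.1

/-- The standard mesh sequence `s n = 1/(n+1) → 0⁺`. [folklore] -/
theorem tendsto_inv_succ_nhdsGT :
    Tendsto (fun n : ℕ => 1 / ((n : ℝ) + 1)) atTop (𝓝[>] (0 : ℝ)) :=
  tendsto_nhdsWithin_iff.2
    ⟨tendsto_one_div_add_atTop_nhds_zero_nat,
      Eventually.of_forall fun n => Set.mem_Ioi.2 (by positivity)⟩

/-! ## §0b Toolkit: an honest endpoint approximation of the unit disc

Re-hosted (as reusable lemmas) from the `have`s of the in-tree refutation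
`Theorems/SAWParafermionTightRefutation.lean`: the mesh graph of the disc is connected, so `Ω_δ` is
all of `δℤ² ∩ 𝔻`, and `stdA δ = (⌈δ⁻¹⌉ - 1, 0) → 1 = a`, `stdB δ = -stdA δ → -1 = b` is an endpoint
approximation of `(𝔻; 1, -1)`. Used to build witnesses that are HONEST near `0⁺` and degenerate only
where the weakened hypothesis no longer looks. -/

/-- `|δ·x|² = δ² (x₀² + x₁²)`. [folklore] -/
theorem normSq_meshPoint (δ : ℝ) (x : Site 2) :
    Complex.normSq (meshPoint δ x) = δ ^ 2 * ((x 0 : ℝ) ^ 2 + (x 1 : ℝ) ^ 2) := by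
  rw [Complex.normSq_apply, meshPoint_re, meshPoint_im]; ring

theorem mem_ball_of_sq_le {δ : ℝ} {x y : Site 2} (hx : meshPoint δ x ∈ Metric.ball (0 : ℂ) 1)
    (h : (y 0 : ℝ) ^ 2 + (y 1 : ℝ) ^ 2 ≤ (x 0 : ℝ) ^ 2 + (x 1 : ℝ) ^ 2) :
    meshPoint δ y ∈ Metric.ball (0 : ℂ) 1 := by
  rw [Metric.mem_ball, dist_zero_right] at hx ⊢
  have hx2 : ‖meshPoint δ x‖ ^ 2 < 1 := by
    have := norm_nonneg (meshPoint δ x); nlinarith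
  have hy2 : ‖meshPoint δ y‖ ^ 2 ≤ ‖meshPoint δ x‖ ^ 2 := by
    rw [Complex.sq_norm, Complex.sq_norm, normSq_meshPoint, normSq_meshPoint]
    exact mul_le_mul_of_nonneg_left h (sq_nonneg δ)
  have hy1 : ‖meshPoint δ y‖ ^ 2 < 1 := hy2.trans_lt hx2
  nlinarith [norm_nonneg (meshPoint δ y)]

/-- One lattice step towards the origin, decreasing `|x₀| + |x₁|` and not increasing the norm.
[folklore] -/
theorem exists_step (x : Site 2) (hx : x ≠ 0) :
    ∃ y : Site 2, (zdGraph 2).Adj x y ∧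
      (y 0 : ℝ) ^ 2 + (y 1 : ℝ) ^ 2 ≤ (x 0 : ℝ) ^ 2 + (x 1 : ℝ) ^ 2 ∧
      (y 0).natAbs + (y 1).natAbs < (x 0).natAbs + (x 1).natAbs := by
  by_cases h0 : x 0 = 0
  · have h1 : x 1 ≠ 0 := by
      intro h1; apply hx; funext i; fin_cases i <;> simp [h0, h1]
    rcases lt_or_gt_of_ne h1 with hneg | hpos
    · refine ⟨x + Pi.single 1 1, (zdGraph_adj_iff _ _).2 ⟨1, Or.inl rfl⟩, ?_, ?_⟩
      · simp only [Pi.add_apply, Pi.single_eq_same, Pi.single_eq_of_ne (zero_ne_one), add_zero,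
          Int.cast_add, Int.cast_one]
        have : (x 1 : ℝ) ≤ -1 := by exact_mod_cast Int.le_sub_one_of_lt hneg
        nlinarith
      · simp only [Pi.add_apply, Pi.single_eq_same, Pi.single_eq_of_ne (zero_ne_one), add_zero]
        omega
    · refine ⟨x - Pi.single 1 1, (zdGraph_adj_iff _ _).2 ⟨1, Or.inr (by simp)⟩, ?_, ?_⟩
      · simp only [Pi.sub_apply, Pi.single_eq_same, Pi.single_eq_of_ne (zero_ne_one), sub_zero,
          Int.cast_sub, Int.cast_one]
        have : (1 : ℝ) ≤ x 1 := by exact_mod_cast hpos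
        nlinarith
      · simp only [Pi.sub_apply, Pi.single_eq_same, Pi.single_eq_of_ne (zero_ne_one), sub_zero]
        omega
  · rcases lt_or_gt_of_ne h0 with hneg | hpos
    · refine ⟨x + Pi.single 0 1, (zdGraph_adj_iff _ _).2 ⟨0, Or.inl rfl⟩, ?_, ?_⟩
      · simp only [Pi.add_apply, Pi.single_eq_same, Pi.single_eq_of_ne (one_ne_zero), add_zero,
          Int.cast_add, Int.cast_one]
        have : (x 0 : ℝ) ≤ -1 := by exact_mod_cast Int.le_sub_one_of_lt hneg
        nlinarith
      · simp only [Pi.add_apply, Pi.single_eq_same, Pi.single_eq_of_ne (one_ne_zero), add_zero]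
        omega
    · refine ⟨x - Pi.single 0 1, (zdGraph_adj_iff _ _).2 ⟨0, Or.inr (by simp)⟩, ?_, ?_⟩
      · simp only [Pi.sub_apply, Pi.single_eq_same, Pi.single_eq_of_ne (one_ne_zero), sub_zero,
          Int.cast_sub, Int.cast_one]
        have : (1 : ℝ) ≤ x 0 := by exact_mod_cast hpos
        nlinarith
      · simp only [Pi.sub_apply, Pi.single_eq_same, Pi.single_eq_of_ne (one_ne_zero), sub_zero]
        omega

/-- The origin is a mesh vertex of the disc at every mesh. [folklore] -/
theorem zero_mem_meshVertices_ball (δ : ℝ) : (0 : Site 2) ∈ meshVertices (Metric.ball (0 : ℂ) 1) δ := by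
  simp [meshVertices, meshPoint_zero δ]

/-- Neighbouring lattice points of the disc are joined in its mesh graph (convexity). [folklore] -/
theorem meshGraph_ball_adj {δ : ℝ} {x y : Site 2} (hxy : (zdGraph 2).Adj x y)
    (hx : meshPoint δ x ∈ Metric.ball (0 : ℂ) 1) (hy : meshPoint δ y ∈ Metric.ball (0 : ℂ) 1) :
    (meshGraph (Metric.ball (0 : ℂ) 1) δ).Adj x y :=
  meshGraph_adj_iff.2 ⟨hxy, ((convex_ball (0 : ℂ) 1).segment_subset hx hy).trans subset_closure⟩

/-- Every mesh vertex of the disc is joined to the origin inside the mesh vertex graph. [folklore] -/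
theorem reachable_zero_ball (δ : ℝ) : ∀ (n : ℕ) (x : Site 2)
    (hx : x ∈ meshVertices (Metric.ball (0 : ℂ) 1) δ), (x 0).natAbs + (x 1).natAbs = n →
    (meshVertexGraph (Metric.ball (0 : ℂ) 1) δ).Reachable ⟨x, hx⟩ ⟨0, zero_mem_meshVertices_ball δ⟩ := by
  intro n
  induction n using Nat.strong_induction_on with
  | _ n ih =>
    intro x hx hn
    by_cases h0 : x = 0
    · subst h0; rfl
    obtain ⟨y, hadj, hle, hlt⟩ := exists_step x h0
    have hy : y ∈ meshVertices (Metric.ball (0 : ℂ) 1) δ := mem_ball_of_sq_le hx hle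
    have h1 : (meshVertexGraph (Metric.ball (0 : ℂ) 1) δ).Adj ⟨x, hx⟩ ⟨y, hy⟩ := by
      simp only [SimpleGraph.comap_adj, Function.Embedding.subtype_apply]
      exact meshGraph_ball_adj hadj hx hy
    exact h1.reachable.trans (ih _ (hn ▸ hlt) y hy rfl)

/-- The mesh vertex graph of the unit disc is preconnected at every mesh. [folklore] -/
theorem meshVertexGraph_ball_preconnected (δ : ℝ) :
    (meshVertexGraph (Metric.ball (0 : ℂ) 1) δ).Preconnected := fun u v =>
  (reachable_zero_ball δ _ u.1 u.2 rfl).trans (reachable_zero_ball δ _ v.1 v.2 rfl).symm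

/-- For the disc, `Ω_δ` is all of `δℤ² ∩ 𝔻` (one component only). [folklore] -/
theorem mem_meshDomain_ball {δ : ℝ} {x : Site 2} (hx : x ∈ meshVertices (Metric.ball (0 : ℂ) 1) δ) :
    x ∈ meshDomain (Metric.ball (0 : ℂ) 1) δ := by
  have hsub := (meshVertexGraph_ball_preconnected δ).subsingleton_connectedComponent
  simp only [meshDomain, Set.mem_iUnion, Set.mem_image]
  refine ⟨(meshVertexGraph (Metric.ball (0 : ℂ) 1) δ).connectedComponentMk ⟨x, hx⟩,
    fun C' => ?_, ⟨x, hx⟩, ?_, rfl⟩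
  · rw [Subsingleton.elim C'
      ((meshVertexGraph (Metric.ball (0 : ℂ) 1) δ).connectedComponentMk ⟨x, hx⟩)]
  · rw [SimpleGraph.ConnectedComponent.mem_supp_iff]

/-- Any two lattice points of the disc are joined in `Ω_δ`. [folklore] -/
theorem reachable_ball {δ : ℝ} {x y : Site 2} (hx : meshPoint δ x ∈ Metric.ball (0 : ℂ) 1)
    (hy : meshPoint δ y ∈ Metric.ball (0 : ℂ) 1) :
    (discreteDomainGraph (Metric.ball (0 : ℂ) 1) δ).Reachable x y := by
  let hom : meshVertexGraph (Metric.ball (0 : ℂ) 1) δ →g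
      discreteDomainGraph (Metric.ball (0 : ℂ) 1) δ :=
    { toFun := Subtype.val
      map_rel' := fun {u v} h =>
        discreteDomainGraph_adj_iff.2 ⟨h, mem_meshDomain_ball u.2, mem_meshDomain_ball v.2⟩ }
  exact (meshVertexGraph_ball_preconnected δ ⟨x, hx⟩ ⟨y, hy⟩).map hom

/-- The honest left endpoint `(⌈δ⁻¹⌉ - 1, 0)`, at distance `≤ δ` from `a = 1` inside the disc. -/
def stdA (δ : ℝ) : Site 2 := ![⌈δ⁻¹⌉ - 1, 0]

/-- The honest right endpoint `(-(⌈δ⁻¹⌉ - 1), 0)`, at distance `≤ δ` from `b = -1`. -/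
def stdB (δ : ℝ) : Site 2 := ![-(⌈δ⁻¹⌉ - 1), 0]

theorem meshPoint_vec (δ : ℝ) (m : ℤ) : meshPoint δ ![m, 0] = ((δ * m : ℝ) : ℂ) :=
  Complex.ext (by simp) (by simp)

theorem near_bounds {δ : ℝ} (hδ : 0 < δ) :
    1 - δ ≤ δ * ((⌈δ⁻¹⌉ - 1 : ℤ) : ℝ) ∧ δ * ((⌈δ⁻¹⌉ - 1 : ℤ) : ℝ) < 1 := by
  have h1 : ((⌈δ⁻¹⌉ - 1 : ℤ) : ℝ) < δ⁻¹ := by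
    push_cast; linarith [Int.ceil_lt_add_one (δ⁻¹)]
  have h2 : δ⁻¹ - 1 ≤ ((⌈δ⁻¹⌉ - 1 : ℤ) : ℝ) := by
    push_cast; linarith [Int.le_ceil (δ⁻¹)]
  have hδinv : δ * δ⁻¹ = 1 := mul_inv_cancel₀ hδ.ne'
  constructor
  · nlinarith
  · nlinarith

theorem stdA_mem {δ : ℝ} (hδ : 0 < δ) (hδ2 : δ < 2) :
    meshPoint δ (stdA δ) ∈ Metric.ball (0 : ℂ) 1 := by
  rw [stdA, meshPoint_vec, Metric.mem_ball, dist_zero_right, Complex.norm_real, Real.norm_eq_abs,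
    abs_lt]
  obtain ⟨h1, h2⟩ := near_bounds hδ
  constructor <;> linarith

theorem meshPoint_stdB (δ : ℝ) : meshPoint δ (stdB δ) = -meshPoint δ (stdA δ) := by
  rw [stdA, stdB, meshPoint_vec, meshPoint_vec]; push_cast; ring

theorem stdB_mem {δ : ℝ} (hδ : 0 < δ) (hδ2 : δ < 2) :
    meshPoint δ (stdB δ) ∈ Metric.ball (0 : ℂ) 1 := by
  rw [meshPoint_stdB, Metric.mem_ball, dist_zero_right, norm_neg, ← dist_zero_right,
    ← Metric.mem_ball]
  exact stdA_mem hδ hδ2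

theorem dist_stdA_le {δ : ℝ} (hδ : 0 < δ) : dist (meshPoint δ (stdA δ)) 1 ≤ δ := by
  rw [stdA, meshPoint_vec, ← Complex.ofReal_one, Complex.dist_eq, ← Complex.ofReal_sub,
    Complex.norm_real, Real.norm_eq_abs, abs_le]
  obtain ⟨h1, h2⟩ := near_bounds hδ
  constructor <;> linarith

theorem dist_stdB_le {δ : ℝ} (hδ : 0 < δ) : dist (meshPoint δ (stdB δ)) (-1) ≤ δ := by
  rw [meshPoint_stdB, dist_neg_neg]
  exact dist_stdA_le hδ

/-- `δ · stdA δ → 1 = a` along `δ → 0⁺`. [folklore] -/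
theorem tendsto_meshPoint_stdA : Tendsto (fun δ => meshPoint δ (stdA δ)) (𝓝[>] (0 : ℝ)) (𝓝 1) := by
  rw [Metric.tendsto_nhds]
  intro ε hε
  filter_upwards [Ioo_mem_nhdsGT hε] with δ hδ
  exact (dist_stdA_le hδ.1).trans_lt hδ.2

/-- `δ · stdB δ → -1 = b` along `δ → 0⁺`. [folklore] -/
theorem tendsto_meshPoint_stdB :
    Tendsto (fun δ => meshPoint δ (stdB δ)) (𝓝[>] (0 : ℝ)) (𝓝 (-1)) := by
  rw [Metric.tendsto_nhds]
  intro ε hε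
  filter_upwards [Ioo_mem_nhdsGT hε] with δ hδ
  exact (dist_stdB_le hδ.1).trans_lt hδ.2

/-- `stdA, stdB` are joined in `Ω_δ` for `δ ∈ (0, 2)`. [folklore] -/
theorem reachable_stdA_stdB {δ : ℝ} (hδ : 0 < δ) (hδ2 : δ < 2) :
    (discreteDomainGraph DobrushinDomain.unitDisc.carrier δ).Reachable (stdA δ) (stdB δ) :=
  reachable_ball (stdA_mem hδ hδ2) (stdB_mem hδ hδ2)

/-- **An honest endpoint approximation of `(𝔻; 1, -1)`** (non-vacuity of `IsEndpointApprox`, and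
the raw material of the witnesses below). [folklore] -/
theorem isEndpointApprox_std : IsEndpointApprox DobrushinDomain.unitDisc stdA stdB := by
  refine ⟨?_, ?_, ?_⟩
  · filter_upwards [Ioo_mem_nhdsGT (by norm_num : (0 : ℝ) < 2)] with δ hδ
    exact reachable_stdA_stdB hδ.1 hδ.2
  · rw [unitDisc_pt_zero]; exact tendsto_meshPoint_stdA
  · rw [unitDisc_pt_one]; exact tendsto_meshPoint_stdB

/-- `IsEndpointApprox` only sees the germ of `(a, b)` at `0⁺`. [folklore] -/
theorem isEndpointApprox_congr {D : DobrushinDomain} {a b a' b' : ℝ → Site 2}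
    (h : IsEndpointApprox D a b) (ha : a =ᶠ[𝓝[>] (0 : ℝ)] a') (hb : b =ᶠ[𝓝[>] (0 : ℝ)] b') :
    IsEndpointApprox D a' b' := by
  refine ⟨?_, ?_, ?_⟩
  · filter_upwards [h.reachable, ha, hb] with δ h1 h2 h3
    rwa [← h2, ← h3]
  · exact h.tendsto_fst.congr' (ha.mono fun δ hδ => by rw [hδ])
  · exact h.tendsto_snd.congr' (hb.mono fun δ hδ => by rw [hδ])

/-- The test integrals between endpoints that are EQUAL (propositionally) to a common `w`
(dependent-type-friendly form of `integral_law_self`). [folklore] -/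
theorem integral_law_of_eq {Ω : Set ℂ} {δ : ℝ} {u v w : Site 2} (hu : u = w) (hv : v = w)
    (f : CurveClass ℂ →ᵇ ℝ) :
    ∫ γ, f γ.curve ∂(law Ω δ u v) = f (constClass (meshPoint δ w)) := by
  subst hu hv; exact integral_law_self _ _ _ f

/-- `constClass` is `1`-Lipschitz (constant curves are as far apart as their points). [folklore] -/
theorem lipschitzWith_constClass : LipschitzWith 1 constClass := by
  refine LipschitzWith.mk_one fun z z' => ?_
  rw [constClass, constClass, CurveClass.dist_mk_mk]
  refine (Curve.dist_le_dist_toContinuousMap _ _).trans ?_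
  refine (ContinuousMap.dist_le dist_nonneg).2 fun t => ?_
  simp [Curve.const]

/-- `constClass` is continuous. [folklore] -/
theorem continuous_constClass : Continuous constClass :=
  lipschitzWith_constClass.continuous

/-! ## §1 Load-bearing analysis: the endpoint hypothesis -/

/-- The crux with `IsEndpointApprox D a b` DROPPED altogether. -/
def SubseqIdentificationWithoutEndpointApprox : Prop :=
  ∀ (D : DobrushinDomain) (a b : ℝ → Site 2) (s : ℕ → ℝ) (μ : Measure (CurveClass ℂ)),
    Tendsto s atTop (𝓝[>] (0 : ℝ)) → IsProbabilityMeasure μ →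
    (∀ f : CurveClass ℂ →ᵇ ℝ, Tendsto (fun n => ∫ γ, f γ.curve
      ∂(law D.carrier (s n) (a (s n)) (b (s n)))) atTop (𝓝 (∫ x, f x ∂μ))) →
    IsSLELaw ((8 : ℝ≥0) / 3) D μ

/-- The crux with `IsEndpointApprox` WEAKENED to its `reachable` field only (the two endpoint limits
`δ·a δ → a`, `δ·b δ → b` dropped). -/
def SubseqIdentificationWithoutEndpointLimits : Prop :=
  ∀ (D : DobrushinDomain) (a b : ℝ → Site 2),
    (∀ᶠ δ in 𝓝[>] (0 : ℝ), (discreteDomainGraph D.carrier δ).Reachable (a δ) (b δ)) →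
    ∀ (s : ℕ → ℝ) (μ : Measure (CurveClass ℂ)),
    Tendsto s atTop (𝓝[>] (0 : ℝ)) → IsProbabilityMeasure μ →
    (∀ f : CurveClass ℂ →ᵇ ℝ, Tendsto (fun n => ∫ γ, f γ.curve
      ∂(law D.carrier (s n) (a (s n)) (b (s n)))) atTop (𝓝 (∫ x, f x ∂μ))) →
    IsSLELaw ((8 : ℝ≥0) / 3) D μ

/-- **`reachable` alone is not enough; the endpoint LIMITS are load-bearing.** Witness: the unit disc
`(𝔻; 1, -1)`, coincident endpoints `a δ = b δ = 0` (trivially joined), `s n = 1/(n+1)`: every law is the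
Dirac mass at the trivial walk, whose class is `constClass 0` at every mesh, so the laws converge to
`μ = dirac (constClass 0)`, which starts at `0 ≠ 1 = a`, hence is no SLE law. Any proof of the crux
must therefore use `IsEndpointApprox.tendsto_fst` / `tendsto_snd`. [folklore] -/
theorem subseqIdentification_false_without_endpointLimits :
    ¬ SubseqIdentificationWithoutEndpointLimits := by
  intro h
  refine not_isSLELaw_dirac_of_source_ne (κ := (8 : ℝ≥0) / 3) (D := DobrushinDomain.unitDisc)
    (c := constClass 0) ?_ (h DobrushinDomain.unitDisc (fun _ => 0) (fun _ => 0)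
      (Eventually.of_forall fun δ => SimpleGraph.Reachable.refl _) _ _ tendsto_inv_succ_nhdsGT
      inferInstance fun f => ?_)
  · rw [source_constClass, unitDisc_pt_zero]
    norm_num
  · have hn : ∀ n : ℕ, ∫ γ, f γ.curve ∂(law DobrushinDomain.unitDisc.carrier (1 / ((n : ℝ) + 1))
        ((fun _ : ℝ => (0 : Site 2)) (1 / ((n : ℝ) + 1)))
        ((fun _ : ℝ => (0 : Site 2)) (1 / ((n : ℝ) + 1)))) = ∫ x, f x ∂(Measure.dirac (constClass 0)) := by
      intro n
      rw [integral_law_self, meshPoint_zero, integral_dirac]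
    simp_rw [hn]
    exact tendsto_const_nhds

/-- **`IsEndpointApprox` is load-bearing** (immediate from the previous theorem: dropping the whole
hypothesis is weaker than keeping `reachable`). [folklore] -/
theorem subseqIdentification_false_without_endpointApprox :
    ¬ SubseqIdentificationWithoutEndpointApprox := fun h =>
  subseqIdentification_false_without_endpointLimits fun D a b _ => h D a b

/-- The crux with ONLY `tendsto_snd` dropped from `IsEndpointApprox` (`reachable` and `δ·a δ → a`
kept). -/
def SubseqIdentificationWithoutSndLimit : Prop :=
  ∀ (D : DobrushinDomain) (a b : ℝ → Site 2),
    (∀ᶠ δ in 𝓝[>] (0 : ℝ), (discreteDomainGraph D.carrier δ).Reachable (a δ) (b δ)) →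
    Tendsto (fun δ => meshPoint δ (a δ)) (𝓝[>] (0 : ℝ)) (𝓝 (D.pt 0)) →
    ∀ (s : ℕ → ℝ) (μ : Measure (CurveClass ℂ)),
    Tendsto s atTop (𝓝[>] (0 : ℝ)) → IsProbabilityMeasure μ →
    (∀ f : CurveClass ℂ →ᵇ ℝ, Tendsto (fun n => ∫ γ, f γ.curve
      ∂(law D.carrier (s n) (a (s n)) (b (s n)))) atTop (𝓝 (∫ x, f x ∂μ))) →
    IsSLELaw ((8 : ℝ≥0) / 3) D μ

/-- The crux with ONLY `tendsto_fst` dropped from `IsEndpointApprox`. -/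
def SubseqIdentificationWithoutFstLimit : Prop :=
  ∀ (D : DobrushinDomain) (a b : ℝ → Site 2),
    (∀ᶠ δ in 𝓝[>] (0 : ℝ), (discreteDomainGraph D.carrier δ).Reachable (a δ) (b δ)) →
    Tendsto (fun δ => meshPoint δ (b δ)) (𝓝[>] (0 : ℝ)) (𝓝 (D.pt 1)) →
    ∀ (s : ℕ → ℝ) (μ : Measure (CurveClass ℂ)),
    Tendsto s atTop (𝓝[>] (0 : ℝ)) → IsProbabilityMeasure μ →
    (∀ f : CurveClass ℂ →ᵇ ℝ, Tendsto (fun n => ∫ γ, f γ.curve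
      ∂(law D.carrier (s n) (a (s n)) (b (s n)))) atTop (𝓝 (∫ x, f x ∂μ))) →
    IsSLELaw ((8 : ℝ≥0) / 3) D μ

/-- Test integrals along coincident moving endpoints `a = b = e`: evaluation of `f` at the constant
class at `δ·e δ`, which converges whenever `δ·e δ` does. [folklore] -/
theorem tendsto_integral_coincident {Ω : Set ℂ} (e : ℝ → Site 2) {s : ℕ → ℝ} {z : ℂ}
    (he : Tendsto (fun n => meshPoint (s n) (e (s n))) atTop (𝓝 z)) (f : CurveClass ℂ →ᵇ ℝ) :
    Tendsto (fun n => ∫ γ, f γ.curve ∂(law Ω (s n) (e (s n)) (e (s n)))) atTop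
      (𝓝 (∫ x, f x ∂(Measure.dirac (constClass z)))) := by
  have hn : (fun n => ∫ γ, f γ.curve ∂(law Ω (s n) (e (s n)) (e (s n)))) =
      fun n => f (constClass (meshPoint (s n) (e (s n)))) :=
    funext fun n => integral_law_self Ω (s n) (e (s n)) f
  rw [hn, integral_dirac]
  exact ((f.continuous.comp continuous_constClass).tendsto z).comp he

/-- **`tendsto_snd` is load-bearing on its own.** Witness: `(𝔻; 1, -1)`, `a = b = stdA` (coincident,
joined, `δ·stdA δ → 1 = a`), `s n = 1/(n+1)`: the laws are Dirac masses at constant classes at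
`δ·stdA δ → 1`, converging to `μ = dirac (constClass 1)`, whose END point is `1 ≠ -1 = b`. [folklore] -/
theorem subseqIdentification_false_without_sndLimit : ¬ SubseqIdentificationWithoutSndLimit := by
  intro h
  have hlim : Tendsto (fun n : ℕ => meshPoint (1 / ((n : ℝ) + 1)) (stdA (1 / ((n : ℝ) + 1)))) atTop
      (𝓝 1) := tendsto_meshPoint_stdA.comp tendsto_inv_succ_nhdsGT
  refine not_isSLELaw_dirac_of_target_ne (κ := (8 : ℝ≥0) / 3) (D := DobrushinDomain.unitDisc)
    (c := constClass 1) ?_ (h DobrushinDomain.unitDisc stdA stdA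
      (Eventually.of_forall fun δ => SimpleGraph.Reachable.refl _)
      (by rw [unitDisc_pt_zero]; exact tendsto_meshPoint_stdA) _ _ tendsto_inv_succ_nhdsGT
      inferInstance fun f => tendsto_integral_coincident stdA hlim f)
  rw [target_constClass, unitDisc_pt_one]
  norm_num

/-- **`tendsto_fst` is load-bearing on its own.** Mirror witness `a = b = stdB → -1 = b`: the limit
`dirac (constClass (-1))` STARTS at `-1 ≠ 1 = a`. [folklore] -/
theorem subseqIdentification_false_without_fstLimit : ¬ SubseqIdentificationWithoutFstLimit := by
  intro h
  have hlim : Tendsto (fun n : ℕ => meshPoint (1 / ((n : ℝ) + 1)) (stdB (1 / ((n : ℝ) + 1)))) atTop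
      (𝓝 (-1)) := tendsto_meshPoint_stdB.comp tendsto_inv_succ_nhdsGT
  refine not_isSLELaw_dirac_of_source_ne (κ := (8 : ℝ≥0) / 3) (D := DobrushinDomain.unitDisc)
    (c := constClass (-1)) ?_ (h DobrushinDomain.unitDisc stdB stdB
      (Eventually.of_forall fun δ => SimpleGraph.Reachable.refl _)
      (by rw [unitDisc_pt_one]; exact tendsto_meshPoint_stdB) _ _ tendsto_inv_succ_nhdsGT
      inferInstance fun f => tendsto_integral_coincident stdB hlim f)
  rw [source_constClass, unitDisc_pt_zero]
  norm_num

/-! ## §1c Load-bearing analysis: `IsProbabilityMeasure μ` is NOT load-bearing (it is derivable) -/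

/-- Under an endpoint approximation the critical SAW laws are eventually probability measures
(re-hosted from the route's deciding theorem `closes`: `a δ, b δ` joined ⇒ a SAW exists, positive
weight; `Ω_δ` finite ⇒ finitely many SAWs, finite total weight). [folklore] -/
theorem eventually_isProbabilityMeasure_law {D : DobrushinDomain} {a b : ℝ → Site 2}
    (hab : IsEndpointApprox D a b) :
    ∀ᶠ δ in 𝓝[>] (0 : ℝ), IsProbabilityMeasure (law D.carrier δ (a δ) (b δ)) := by
  classical
  have hxc : 0 < Literature.Probability.RandomPlanarGeometry.SAW.criticalFugacity := by
    have h := Literature.Probability.RandomPlanarGeometry.SAW.Zd.connectiveConstant_pos 2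
    rw [Literature.Probability.RandomPlanarGeometry.SAW.Zd.connectiveConstant_two] at h
    unfold Literature.Probability.RandomPlanarGeometry.SAW.criticalFugacity
    exact inv_pos.2 h
  -- (1) for all small `δ > 0` the critical SAW law of `Ω_δ` from `a_δ` to `b_δ` is a probability
  -- measure: `a_δ, b_δ` are joined (a SAW exists, positive weight) and `Ω_δ` is finite (finitely
  -- many SAWs, finite total weight)
  have hprob : ∀ᶠ δ in 𝓝[>] (0 : ℝ), IsProbabilityMeasure
      (Literature.Probability.RandomPlanarGeometry.SAW.law D.carrier δ (a δ) (b δ)) := by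
    filter_upwards [hab.reachable, self_mem_nhdsWithin] with δ hreach hδpos
    have hδ : (0 : ℝ) < δ := hδpos
    have hfin : (Literature.Probability.LatticeModels.meshDomain D.carrier δ).Finite :=
      Literature.Probability.LatticeModels.meshDomain_finite D.isBounded hδ
    haveI hLF : (Literature.Probability.LatticeModels.discreteDomainGraph D.carrier δ).LocallyFinite :=
      fun v => (hfin.subset fun w hw =>
        (Literature.Probability.LatticeModels.discreteDomainGraph_adj_iff.1
          ((SimpleGraph.mem_neighborSet _ _ _).1 hw)).2.2).fintype
    -- every vertex of a walk of `Ω_δ` after the first lies in `Ω_δ`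
    have hsupp : ∀ {u v : Literature.Probability.LatticeModels.Site 2}
        (p : (Literature.Probability.LatticeModels.discreteDomainGraph D.carrier δ).Walk u v),
        ∀ w ∈ p.support.tail, w ∈ Literature.Probability.LatticeModels.meshDomain D.carrier δ := by
      intro u v p
      induction p with
      | nil => intro w hw; simp at hw
      | cons h q ih =>
        intro w hw
        rw [SimpleGraph.Walk.support_cons, List.tail_cons, SimpleGraph.Walk.mem_support_iff] at hw
        rcases hw with rfl | hw
        · exact (Literature.Probability.LatticeModels.discreteDomainGraph_adj_iff.1 h).2.2
        · exact ih w hw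
    -- hence a self-avoiding walk of `Ω_δ` has at most `|Ω_δ|` steps
    have hlen : ∀ {u v : Literature.Probability.LatticeModels.Site 2}
        (p : (Literature.Probability.LatticeModels.discreteDomainGraph D.carrier δ).Walk u v),
        p.IsPath → p.length < hfin.toFinset.card + 1 := by
      intro u v p hp
      have hnd : p.support.tail.Nodup := List.Nodup.sublist (List.tail_sublist _) hp.support_nodup
      have h1 : p.support.tail.length = p.length := by
        rw [List.length_tail, SimpleGraph.Walk.length_support]
        rfl
      have h2 : p.support.tail.toFinset ⊆ hfin.toFinset := by
        intro w hw
        rw [Set.Finite.mem_toFinset]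
        exact hsupp p w (List.mem_toFinset.1 hw)
      have h3 := Finset.card_le_card h2
      rw [List.toFinset_card_of_nodup hnd, h1] at h3
      omega
    haveI hfinite : Finite
        (Literature.Probability.RandomPlanarGeometry.SAW.DomainSAW D.carrier δ (a δ) (b δ)) := by
      refine Finite.of_injective
        (β := {p : (Literature.Probability.LatticeModels.discreteDomainGraph D.carrier δ).Walk
          (a δ) (b δ) // p.IsPath ∧ p.length < hfin.toFinset.card + 1})
        (fun γ => ⟨γ.walk, γ.isPath, hlen γ.walk γ.isPath⟩) ?_
      rintro ⟨p, hp⟩ ⟨q, hq⟩ h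
      have hpq : p = q := congrArg Subtype.val h
      cases hpq
      rfl
    haveI := Fintype.ofFinite
      (Literature.Probability.RandomPlanarGeometry.SAW.DomainSAW D.carrier δ (a δ) (b δ))
    -- total weight: finite …
    have huniv : Literature.Probability.RandomPlanarGeometry.SAW.weight D.carrier δ (a δ) (b δ)
        Set.univ = ∑' γ : Literature.Probability.RandomPlanarGeometry.SAW.DomainSAW D.carrier δ
          (a δ) (b δ), ENNReal.ofReal
            (Literature.Probability.RandomPlanarGeometry.SAW.criticalFugacity ^ γ.length) := by
      rw [Literature.Probability.RandomPlanarGeometry.SAW.weight,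
        MeasureTheory.Measure.sum_apply _ MeasurableSet.univ]
      simp
    have htop : Literature.Probability.RandomPlanarGeometry.SAW.weight D.carrier δ (a δ) (b δ)
        Set.univ ≠ ⊤ := by
      rw [huniv, tsum_fintype]
      exact ENNReal.sum_ne_top.2 fun _ _ => ENNReal.ofReal_ne_top
    -- … and positive
    have h0 : Literature.Probability.RandomPlanarGeometry.SAW.weight D.carrier δ (a δ) (b δ)
        Set.univ ≠ 0 := by
      obtain ⟨p⟩ := hreach
      let γ₀ : Literature.Probability.RandomPlanarGeometry.SAW.DomainSAW D.carrier δ (a δ) (b δ) :=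
        ⟨p.bypass, p.bypass_isPath⟩
      have h1 : Literature.Probability.RandomPlanarGeometry.SAW.weight D.carrier δ (a δ) (b δ) {γ₀}
          ≤ Literature.Probability.RandomPlanarGeometry.SAW.weight D.carrier δ (a δ) (b δ)
            Set.univ := measure_mono (Set.subset_univ _)
      rw [Literature.Probability.RandomPlanarGeometry.SAW.weight_singleton] at h1
      have h2 : 0 < ENNReal.ofReal
          (Literature.Probability.RandomPlanarGeometry.SAW.criticalFugacity ^ γ₀.length) :=
        ENNReal.ofReal_pos.2 (pow_pos hxc _)
      exact (h2.trans_le h1).ne'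
    constructor
    rw [Literature.Probability.RandomPlanarGeometry.SAW.law, Measure.smul_apply, smul_eq_mul,
      ENNReal.inv_mul_cancel h0 htop]
  exact hprob

/-- The crux with `IsProbabilityMeasure μ` DROPPED. -/
def SubseqIdentificationWithoutProb : Prop :=
  ∀ (D : DobrushinDomain) (a b : ℝ → Site 2), IsEndpointApprox D a b →
    ∀ (s : ℕ → ℝ) (μ : Measure (CurveClass ℂ)), Tendsto s atTop (𝓝[>] (0 : ℝ)) →
    (∀ f : CurveClass ℂ →ᵇ ℝ, Tendsto (fun n => ∫ γ, f γ.curve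
      ∂(law D.carrier (s n) (a (s n)) (b (s n)))) atTop (𝓝 (∫ x, f x ∂μ))) →
    IsSLELaw ((8 : ℝ≥0) / 3) D μ

/-- **`IsProbabilityMeasure μ` follows from the other hypotheses**: the laws are eventually
probability measures along `s n → 0⁺`, so the test integral of `f ≡ 1` tends to `1 = μ.real univ`,
whence `μ univ = 1` (`toReal = 1` excludes both `0` and `∞`). [folklore] -/
theorem isProbabilityMeasure_of_hyps {D : DobrushinDomain} {a b : ℝ → Site 2}
    (hab : IsEndpointApprox D a b) {s : ℕ → ℝ} (hs : Tendsto s atTop (𝓝[>] (0 : ℝ)))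
    {μ : Measure (CurveClass ℂ)}
    (hlim : ∀ f : CurveClass ℂ →ᵇ ℝ, Tendsto (fun n => ∫ γ, f γ.curve
      ∂(law D.carrier (s n) (a (s n)) (b (s n)))) atTop (𝓝 (∫ x, f x ∂μ))) :
    IsProbabilityMeasure μ := by
  have hev : ∀ᶠ n in atTop, IsProbabilityMeasure (law D.carrier (s n) (a (s n)) (b (s n))) :=
    hs.eventually (eventually_isProbabilityMeasure_law hab)
  have h1 := hlim 1
  simp only [BoundedContinuousFunction.coe_one, Pi.one_apply, integral_const, smul_eq_mul,
    mul_one] at h1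
  have h2 : Tendsto (fun n => (law D.carrier (s n) (a (s n)) (b (s n))).real univ) atTop (𝓝 1) :=
    tendsto_const_nhds.congr' (hev.mono fun n hn => by
      haveI := hn
      exact probReal_univ.symm)
  have h3 : μ.real univ = 1 := tendsto_nhds_unique h1 h2
  rw [measureReal_def, ENNReal.toReal_eq_one_iff] at h3
  exact ⟨h3⟩

open Summit.CriticalPhenomena.SAWScalingLimit.Theses.SAWRenewalTightness in
/-- **The hypothesis `IsProbabilityMeasure μ` is NOT load-bearing**: the crux is EQUIVALENT to its
version without it. (Information for provers: nothing is gained or lost by it.) [folklore] -/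
theorem subseqIdentification_iff_withoutProb :
    SubseqIdentification ↔ SubseqIdentificationWithoutProb := by
  constructor
  · intro h D a b hab s μ hs hlim
    exact h D a b hab s μ hs (isProbabilityMeasure_of_hyps hab hs hlim) hlim
  · intro h D a b hab s μ hs _ hlim
    exact h D a b hab s μ hs hlim

/-! ## §2 Load-bearing analysis: the mesh hypothesis `s → 0⁺` -/

/-- The crux with `Tendsto s atTop (𝓝[>] 0)` WEAKENED to the two-sided `Tendsto s atTop (𝓝 0)`
(negative meshes allowed). -/
def SubseqIdentificationWithoutOneSided : Prop :=
  ∀ (D : DobrushinDomain) (a b : ℝ → Site 2), IsEndpointApprox D a b →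
    ∀ (s : ℕ → ℝ) (μ : Measure (CurveClass ℂ)),
    Tendsto s atTop (𝓝 (0 : ℝ)) → IsProbabilityMeasure μ →
    (∀ f : CurveClass ℂ →ᵇ ℝ, Tendsto (fun n => ∫ γ, f γ.curve
      ∂(law D.carrier (s n) (a (s n)) (b (s n)))) atTop (𝓝 (∫ x, f x ∂μ))) →
    IsSLELaw ((8 : ℝ≥0) / 3) D μ

/-- The crux with `Tendsto s atTop (𝓝[>] 0)` WEAKENED to mere positivity `∀ n, 0 < s n` (no
convergence of the mesh to `0`). -/
def SubseqIdentificationWithoutMeshToZero : Prop :=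
  ∀ (D : DobrushinDomain) (a b : ℝ → Site 2), IsEndpointApprox D a b →
    ∀ (s : ℕ → ℝ) (μ : Measure (CurveClass ℂ)),
    (∀ n, 0 < s n) → IsProbabilityMeasure μ →
    (∀ f : CurveClass ℂ →ᵇ ℝ, Tendsto (fun n => ∫ γ, f γ.curve
      ∂(law D.carrier (s n) (a (s n)) (b (s n)))) atTop (𝓝 (∫ x, f x ∂μ))) →
    IsSLELaw ((8 : ℝ≥0) / 3) D μ

/-- **One-sidedness of the mesh filter is load-bearing** (formally): `IsEndpointApprox` constrains
`(a, b)` only on `𝓝[>] 0`, so along NEGATIVE meshes `s n = -1/(n+1) → 0` the endpoints are free;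
patch the honest approximation `(stdA, stdB)` to `a δ = b δ = 0` for `δ ≤ 0`: the laws are
`dirac (trivial walk)`, the limit is `dirac (constClass 0)`, not an SLE law. (Geometrically a negative
mesh is the same lattice `|δ|ℤ²` relabelled by `x ↦ -x`, so nothing is lost by the one-sided filter;
the point is only that the endpoint hypothesis and the mesh filter must look at the same side.)
[folklore] -/
theorem subseqIdentification_false_without_oneSided : ¬ SubseqIdentificationWithoutOneSided := by
  intro h
  set a' : ℝ → Site 2 := fun δ => if 0 < δ then stdA δ else 0 with ha'
  set b' : ℝ → Site 2 := fun δ => if 0 < δ then stdB δ else 0 with hb'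
  have hab : IsEndpointApprox DobrushinDomain.unitDisc a' b' :=
    isEndpointApprox_congr isEndpointApprox_std
      (mem_of_superset self_mem_nhdsWithin fun δ (hδ : 0 < δ) => by simp [ha', hδ])
      (mem_of_superset self_mem_nhdsWithin fun δ (hδ : 0 < δ) => by simp [hb', hδ])
  have hs : Tendsto (fun n : ℕ => -(1 / ((n : ℝ) + 1))) atTop (𝓝 (0 : ℝ)) := by
    have := (tendsto_one_div_add_atTop_nhds_zero_nat (𝕜 := ℝ)).neg
    rwa [neg_zero] at this
  have hneg : ∀ n : ℕ, ¬ (0 : ℝ) < -(1 / ((n : ℝ) + 1)) := fun n => by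
    rw [not_lt, neg_nonpos]; positivity
  have ha0 : ∀ n : ℕ, a' (-(1 / ((n : ℝ) + 1))) = 0 := fun n => if_neg (hneg n)
  have hb0 : ∀ n : ℕ, b' (-(1 / ((n : ℝ) + 1))) = 0 := fun n => if_neg (hneg n)
  refine not_isSLELaw_dirac_of_source_ne (κ := (8 : ℝ≥0) / 3) (D := DobrushinDomain.unitDisc)
    (c := constClass 0) ?_ (h DobrushinDomain.unitDisc a' b' hab _ _ hs inferInstance fun f => ?_)
  · rw [source_constClass, unitDisc_pt_zero]
    norm_num
  · have hn : (fun n : ℕ => ∫ γ, f γ.curve ∂(law DobrushinDomain.unitDisc.carrier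
        (-(1 / ((n : ℝ) + 1))) (a' (-(1 / ((n : ℝ) + 1)))) (b' (-(1 / ((n : ℝ) + 1)))))) =
        fun _ => f (constClass 0) :=
      funext fun n => by rw [integral_law_of_eq (ha0 n) (hb0 n), meshPoint_zero]
    rw [hn, integral_dirac]
    exact tendsto_const_nhds

/-- **Convergence of the mesh to `0` is load-bearing; positivity is not enough.** Witness: the fixed
mesh `s ≡ 2` with the honest approximation patched at `δ = 2` only (`a 2 = b 2 = 0`; invisible to
`IsEndpointApprox`, which looks at `𝓝[>] 0`): the laws are constantly `dirac (trivial walk at 0)`,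
limit `dirac (constClass 0)`, not an SLE law. The same patch at any fixed `δ₀ > 0` refutes
"identification at a fixed positive mesh". [folklore] -/
theorem subseqIdentification_false_without_meshToZero : ¬ SubseqIdentificationWithoutMeshToZero := by
  intro h
  set a' : ℝ → Site 2 := fun δ => if δ = 2 then 0 else stdA δ with ha'
  set b' : ℝ → Site 2 := fun δ => if δ = 2 then 0 else stdB δ with hb'
  have hne : ∀ᶠ δ in 𝓝[>] (0 : ℝ), δ ≠ 2 := by
    filter_upwards [Ioo_mem_nhdsGT (by norm_num : (0 : ℝ) < 2)] with δ hδ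
    exact hδ.2.ne
  have hab : IsEndpointApprox DobrushinDomain.unitDisc a' b' :=
    isEndpointApprox_congr isEndpointApprox_std
      (hne.mono fun δ hδ => by simp [ha', hδ]) (hne.mono fun δ hδ => by simp [hb', hδ])
  have ha0 : a' 2 = 0 := if_pos rfl
  have hb0 : b' 2 = 0 := if_pos rfl
  refine not_isSLELaw_dirac_of_source_ne (κ := (8 : ℝ≥0) / 3) (D := DobrushinDomain.unitDisc)
    (c := constClass 0) ?_ (h DobrushinDomain.unitDisc a' b' hab (fun _ => 2) _
      (fun _ => by norm_num) inferInstance fun f => ?_)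
  · rw [source_constClass, unitDisc_pt_zero]
    norm_num
  · have hn : (fun n : ℕ => ∫ γ, f γ.curve ∂(law DobrushinDomain.unitDisc.carrier
        ((fun _ : ℕ => (2 : ℝ)) n) (a' ((fun _ : ℕ => (2 : ℝ)) n)) (b' ((fun _ : ℕ => (2 : ℝ)) n)))) =
        fun _ => f (constClass 0) :=
      funext fun n => by rw [integral_law_of_eq ha0 hb0, meshPoint_zero]
    rw [hn, integral_dirac]
    exact tendsto_const_nhds

/-! ## §3 Positive by-products (prover briefing; a refuter cannot land these — attached as evidence)

What the convergence hypothesis already gives for free, and why the endpoint-type obstructions of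
§1–§2 can never bite the crux itself. -/

open Summit.CriticalPhenomena.SAWScalingLimit.Theses.SAWRenewalTightness in
/-- **The crux is NECESSARY for the conjunct.** `SAWScalingLimit → SubseqIdentification`: if the
critical SAW laws converge in law to chordal SLE_{8/3} along `𝓝[>] 0`, then along any `s n → 0⁺`
every weak limit `μ` IS that SLE law (uniqueness of weak limits of finite measures on the metric
space `CurveClass ℂ`, `ext_of_forall_integral_eq_of_IsFiniteMeasure`; the pre-Wiener measure is a
probability measure unconditionally, `isProbabilityMeasure_preWienerMeasure'`). CONSEQUENCE FOR THE
DISPROVER: a kill of this crux is a kill of `SAW.SAWScalingLimit` itself (the LSW conjecture as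
typed), i.e. of every SAW route at once — there is no slack between the crux and the summit conjunct
on the identification side. [folklore] -/
theorem subseqIdentification_of_sawScalingLimit (h : SAW.SAWScalingLimit) : SubseqIdentification := by
  intro D a b hab s μ hs hμ hlim
  obtain ⟨Γ, hΓ, -, hT⟩ := h D a b hab
  haveI := isProbabilityMeasure_preWienerMeasure'
  haveI : IsProbabilityMeasure (Process.preWienerMeasure.map Γ) :=
    Measure.isProbabilityMeasure_map hΓ.aemeasurable
  have key : μ = Process.preWienerMeasure.map Γ := by
    apply ext_of_forall_integral_eq_of_IsFiniteMeasure
    intro f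
    rw [integral_map hΓ.aemeasurable f.continuous.aestronglyMeasurable]
    exact tendsto_nhds_unique (hlim f) ((hT f).comp hs)
  exact ⟨Γ, hΓ, key⟩

open Summit.CriticalPhenomena.SAWScalingLimit.Theses.SAWRenewalTightness in
/-- Contrapositive, for the record: refuting the crux refutes the summit conjunct. [folklore] -/
theorem not_sawScalingLimit_of_not_subseqIdentification (h : ¬ SubseqIdentification) :
    ¬ SAW.SAWScalingLimit := fun h' => h (subseqIdentification_of_sawScalingLimit h')

/-- The total mass of `SAW.law` is `0` (junk: no SAW, or infinite weight) or `1` — no finiteness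
argument needed. [folklore] -/
theorem law_univ_eq_zero_or_one (Ω : Set ℂ) (δ : ℝ) (a b : Site 2) :
    law Ω δ a b univ = 0 ∨ law Ω δ a b univ = 1 := by
  rw [law, Measure.smul_apply, smul_eq_mul]
  rcases eq_or_ne (weight Ω δ a b univ) 0 with h0 | h0
  · left; rw [h0, mul_zero]
  rcases eq_or_ne (weight Ω δ a b univ) ⊤ with ht | ht
  · left; rw [ht, ENNReal.inv_top, zero_mul]
  · right; exact ENNReal.inv_mul_cancel h0 ht

/-- Dichotomy: `SAW.law` is a probability measure or the zero measure. [folklore] -/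
theorem isProbabilityMeasure_law_or_eq_zero (Ω : Set ℂ) (δ : ℝ) (a b : Site 2) :
    IsProbabilityMeasure (law Ω δ a b) ∨ law Ω δ a b = 0 := by
  rcases law_univ_eq_zero_or_one Ω δ a b with h | h
  · exact Or.inr (Measure.measure_univ_eq_zero.1 h)
  · exact Or.inl ⟨h⟩

/-- A probability SAW law has joined endpoints (else the space of SAWs is empty and the law is
`0`). [folklore] -/
theorem reachable_of_isProbabilityMeasure_law {Ω : Set ℂ} {δ : ℝ} {a b : Site 2}
    (h : IsProbabilityMeasure (law Ω δ a b)) : (discreteDomainGraph Ω δ).Reachable a b := by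
  by_contra hr
  haveI : IsEmpty (DomainSAW Ω δ a b) := ⟨fun γ => hr γ.walk.reachable⟩
  have h0 : law Ω δ a b univ = 0 := by
    rw [Set.univ_eq_empty_iff.2 ‹_›, measure_empty]
  have h1 : law Ω δ a b univ = 1 := measure_univ
  exact zero_ne_one (h0.symm.trans h1)

/-- **The hypothesis `IsEndpointApprox.reachable` is redundant along the sequence**: convergence of
the test integral of `f ≡ 1` to a probability limit forces the laws to be probability measures
eventually (their mass is `0` or `1` and tends to `1`). [folklore] -/
theorem eventually_isProbabilityMeasure_of_tendsto {Ω : Set ℂ} {a b : ℝ → Site 2} {s : ℕ → ℝ}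
    {μ : Measure (CurveClass ℂ)} [IsProbabilityMeasure μ]
    (hlim : Tendsto (fun n => ∫ γ, (1 : CurveClass ℂ →ᵇ ℝ) γ.curve
      ∂(law Ω (s n) (a (s n)) (b (s n)))) atTop (𝓝 (∫ x, (1 : CurveClass ℂ →ᵇ ℝ) x ∂μ))) :
    ∀ᶠ n in atTop, IsProbabilityMeasure (law Ω (s n) (a (s n)) (b (s n))) := by
  simp only [BoundedContinuousFunction.coe_one, Pi.one_apply, integral_const, smul_eq_mul,
    mul_one, probReal_univ] at hlim
  have hev := hlim.eventually (lt_mem_nhds (show (1 : ℝ) / 2 < 1 by norm_num))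
  filter_upwards [hev] with n hn
  rcases isProbabilityMeasure_law_or_eq_zero Ω (s n) (a (s n)) (b (s n)) with h | h
  · exact h
  · exfalso
    rw [h] at hn
    simp at hn
    linarith

/-- … hence the endpoints are eventually joined along the sequence, with no appeal to
`IsEndpointApprox.reachable`. [folklore] -/
theorem eventually_reachable_of_tendsto {Ω : Set ℂ} {a b : ℝ → Site 2} {s : ℕ → ℝ}
    {μ : Measure (CurveClass ℂ)} [IsProbabilityMeasure μ]
    (hlim : Tendsto (fun n => ∫ γ, (1 : CurveClass ℂ →ᵇ ℝ) γ.curve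
      ∂(law Ω (s n) (a (s n)) (b (s n)))) atTop (𝓝 (∫ x, (1 : CurveClass ℂ →ᵇ ℝ) x ∂μ))) :
    ∀ᶠ n in atTop, (discreteDomainGraph Ω (s n)).Reachable (a (s n)) (b (s n)) :=
  (eventually_isProbabilityMeasure_of_tendsto hlim).mono fun _ h =>
    reachable_of_isProbabilityMeasure_law h

/-- Every SAW curve starts at the mesh point of its first vertex. [folklore] -/
theorem source_curve {Ω : Set ℂ} {δ : ℝ} {a b : Site 2} (γ : DomainSAW Ω δ a b) :
    γ.curve.source = meshPoint δ a := by
  rw [DomainSAW.curve, CurveClass.source_mk, Curve.source_def]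
  exact SimpleGraph.Walk.toCurve_apply_zero _ _

/-- Every SAW curve ends at the mesh point of its last vertex. [folklore] -/
theorem target_curve {Ω : Set ℂ} {δ : ℝ} {a b : Site 2} (γ : DomainSAW Ω δ a b) :
    γ.curve.target = meshPoint δ b := by
  rw [DomainSAW.curve, CurveClass.target_mk, Curve.target_def]
  exact SimpleGraph.Walk.toCurve_apply_one _ _

/-- Truncated distance-of-an-endpoint test function `γ ↦ min 1 (dist (e γ) p)` for a continuous
`e` (used with `e = source, target`). [folklore] -/
def truncDist (e : CurveClass ℂ → ℂ) (he : Continuous e) (p : ℂ) : CurveClass ℂ →ᵇ ℝ :=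
  BoundedContinuousFunction.mkOfBound
    ⟨fun γ => min 1 (dist (e γ) p), continuous_const.min (he.dist continuous_const)⟩ 1
    (fun γ γ' => by
      simp only [ContinuousMap.coe_mk, Real.dist_eq]
      have h1 : 0 ≤ min 1 (dist (e γ) p) := le_min zero_le_one dist_nonneg
      have h2 : min 1 (dist (e γ) p) ≤ 1 := min_le_left _ _
      have h3 : 0 ≤ min 1 (dist (e γ') p) := le_min zero_le_one dist_nonneg
      have h4 : min 1 (dist (e γ') p) ≤ 1 := min_le_left _ _
      rw [abs_le]; constructor <;> linarith)

@[simp] theorem truncDist_apply (e : CurveClass ℂ → ℂ) (he : Continuous e) (p : ℂ) (γ : CurveClass ℂ) :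
    truncDist e he p γ = min 1 (dist (e γ) p) := rfl

/-- Abstract endpoint lemma: if a continuous functional `e` is CONSTANT `= q n` on the support of
the `n`-th law (all SAW curves share their endpoints) with `q n → p`, then `e = p` a.e. for the
weak limit. [folklore] -/
theorem ae_eq_of_tendsto {Ω : Set ℂ} {a b : ℝ → Site 2} {s : ℕ → ℝ} {p : ℂ} {q : ℕ → ℂ}
    {e : CurveClass ℂ → ℂ} (he : Continuous e)
    (hq : ∀ n (γ : DomainSAW Ω (s n) (a (s n)) (b (s n))), e γ.curve = q n)
    (hqp : Tendsto q atTop (𝓝 p))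
    {μ : Measure (CurveClass ℂ)} [IsProbabilityMeasure μ]
    (hlim : ∀ f : CurveClass ℂ →ᵇ ℝ, Tendsto (fun n => ∫ γ, f γ.curve
      ∂(law Ω (s n) (a (s n)) (b (s n)))) atTop (𝓝 (∫ x, f x ∂μ))) :
    ∀ᵐ γ ∂μ, e γ = p := by
  set F := truncDist e he p with hF
  have h1 : ∀ n, ∫ γ, F γ.curve ∂(law Ω (s n) (a (s n)) (b (s n))) =
      (law Ω (s n) (a (s n)) (b (s n))).real univ * min 1 (dist (q n) p) := by
    intro n
    have : (fun γ : DomainSAW Ω (s n) (a (s n)) (b (s n)) => F γ.curve) =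
        fun _ => min 1 (dist (q n) p) := by
      funext γ; rw [hF, truncDist_apply, hq n γ]
    rw [this, integral_const, smul_eq_mul]
  have hmass : ∀ n, 0 ≤ (law Ω (s n) (a (s n)) (b (s n))).real univ ∧
      (law Ω (s n) (a (s n)) (b (s n))).real univ ≤ 1 := by
    intro n
    refine ⟨ENNReal.toReal_nonneg, ?_⟩
    rcases law_univ_eq_zero_or_one Ω (s n) (a (s n)) (b (s n)) with h | h
    · simp [Measure.real, h]
    · simp [Measure.real, h]
  have h0 : Tendsto (fun n => ∫ γ, F γ.curve ∂(law Ω (s n) (a (s n)) (b (s n)))) atTop (𝓝 0) := by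
    have hd : Tendsto (fun n => min 1 (dist (q n) p)) atTop (𝓝 0) := by
      have hc : Continuous fun z : ℂ => min (1 : ℝ) (dist z p) :=
        continuous_const.min (continuous_id.dist continuous_const)
      have h := (hc.tendsto p).comp hqp
      rw [dist_self, min_eq_right zero_le_one] at h
      exact h
    refine squeeze_zero (fun n => ?_) (fun n => ?_) hd
    · rw [h1]; exact mul_nonneg (hmass n).1 (le_min zero_le_one dist_nonneg)
    · rw [h1]
      calc (law Ω (s n) (a (s n)) (b (s n))).real univ * min 1 (dist (q n) p)
          ≤ 1 * min 1 (dist (q n) p) :=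
            mul_le_mul_of_nonneg_right (hmass n).2 (le_min zero_le_one dist_nonneg)
        _ = min 1 (dist (q n) p) := one_mul _
  have hint : ∫ x, F x ∂μ = 0 := tendsto_nhds_unique (hlim F) h0
  have hae : (fun x => F x) =ᵐ[μ] 0 :=
    (integral_eq_zero_iff_of_nonneg
      (fun x => show (0 : CurveClass ℂ → ℝ) x ≤ F x from le_min zero_le_one dist_nonneg)
      (F.integrable μ)).1 hint
  filter_upwards [hae] with γ hγ
  have hγ' : min 1 (dist (e γ) p) = 0 := hγ
  rcases min_eq_iff.1 hγ' with ⟨h, -⟩ | ⟨h, -⟩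
  · exact absurd h one_ne_zero
  · exact dist_eq_zero.1 h

/-- **The cheap necessary conditions of `IsSLELaw` are automatic for subsequential limits**: under
the hypotheses of the crux, `μ`-a.e. curve class starts at `a = D.pt 0` and ends at `b = D.pt 1`
(exactly what `IsSLELaw.ae_endpoints` demands of an SLE law). So no endpoint-based obstruction — the
only kind §1–§2 could manufacture — refutes the crux; a refutation must see the interior geometry of
the limit (simplicity, boundary avoidance, restriction, conformal covariance), i.e. a genuine
estimate on critical SAW. [folklore] -/
theorem ae_endpoints_of_hyps {D : DobrushinDomain} {a b : ℝ → Site 2} (hab : IsEndpointApprox D a b)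
    {s : ℕ → ℝ} (hs : Tendsto s atTop (𝓝[>] (0 : ℝ))) {μ : Measure (CurveClass ℂ)}
    [IsProbabilityMeasure μ]
    (hlim : ∀ f : CurveClass ℂ →ᵇ ℝ, Tendsto (fun n => ∫ γ, f γ.curve
      ∂(law D.carrier (s n) (a (s n)) (b (s n)))) atTop (𝓝 (∫ x, f x ∂μ))) :
    ∀ᵐ γ ∂μ, γ.source = D.pt 0 ∧ γ.target = D.pt 1 := by
  have h1 : ∀ᵐ γ ∂μ, γ.source = D.pt 0 :=
    ae_eq_of_tendsto CurveClass.continuous_source (q := fun n => meshPoint (s n) (a (s n)))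
      (fun n γ => source_curve γ) (hab.tendsto_fst.comp hs) hlim
  have h2 : ∀ᵐ γ ∂μ, γ.target = D.pt 1 :=
    ae_eq_of_tendsto CurveClass.continuous_target (q := fun n => meshPoint (s n) (b (s n)))
      (fun n γ => target_curve γ) (hab.tendsto_snd.comp hs) hlim
  filter_upwards [h1, h2] with γ hγ1 hγ2
  exact ⟨hγ1, hγ2⟩

/-- The trace of the polyline of a trivial walk is its base point (re-hosted from
`Percolation/CLE6Proofs.lean`, not imported here). [folklore] -/
theorem walk_range_toCurve_nil {V E : Type*} [AddCommGroup E] [Module ℝ E] [TopologicalSpace E]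
    [ContinuousAdd E] [ContinuousSMul ℝ E] {G : SimpleGraph V} (emb : V → E) (u : V) :
    Set.range ((SimpleGraph.Walk.nil : G.Walk u u).toCurve emb) = {emb u} := by
  simp [SimpleGraph.Walk.toCurve, polyline]

/-- The trace of the polyline of `cons h p` is the first segment followed by the trace of `p`
(re-hosted from `Percolation/CLE6Proofs.lean`). [folklore] -/
theorem walk_range_toCurve_cons {V E : Type*} [AddCommGroup E] [Module ℝ E] [TopologicalSpace E]
    [ContinuousAdd E] [ContinuousSMul ℝ E] {G : SimpleGraph V} (emb : V → E) {u v w : V}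
    (h : G.Adj u v) (p : G.Walk v w) :
    Set.range ((SimpleGraph.Walk.cons h p).toCurve emb) =
      segment ℝ (emb u) (emb v) ∪ Set.range (p.toCurve emb) := by
  cases p <;> simp [SimpleGraph.Walk.toCurve, polyline, Path.trans_range, Path.range_segment]

/-- The trace of the polyline of a walk lies in any set containing the embedded base vertex and the
closed segment of every dart (re-hosted from `Percolation/CLE6Proofs.lean`). [folklore] -/
theorem walk_range_toCurve_subset {V E : Type*} [AddCommGroup E] [Module ℝ E] [TopologicalSpace E]
    [ContinuousAdd E] [ContinuousSMul ℝ E] {G : SimpleGraph V} {S : Set E} {emb : V → E} :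
    ∀ {u v : V} (p : G.Walk u v), emb u ∈ S →
      (∀ d ∈ p.darts, segment ℝ (emb d.fst) (emb d.snd) ⊆ S) → Set.range (p.toCurve emb) ⊆ S
  | _, _, SimpleGraph.Walk.nil, hu, _ => by
    rw [walk_range_toCurve_nil]
    exact Set.singleton_subset_iff.2 hu
  | _, _, SimpleGraph.Walk.cons h p, _, hd => by
    rw [walk_range_toCurve_cons]
    rw [SimpleGraph.Walk.darts_cons] at hd
    have h1 := hd _ List.mem_cons_self
    exact Set.union_subset h1 (walk_range_toCurve_subset p (h1 (right_mem_segment ℝ _ _))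
      fun d hd' => hd d (List.mem_cons_of_mem _ hd'))

/-- **SAW polylines between distinct endpoints lie in `Ω̄`**: every edge of `Ω_δ` is a closed
segment of `closure Ω` (`meshGraph_adj_iff`), and a walk between distinct vertices starts with an
edge. (For `a = b` the trivial walk at a junk vertex `a ∉ Ω_δ` would escape; excluded below because
the endpoints are eventually distinct.) [folklore] -/
theorem range_curve_subset_closure {Ω : Set ℂ} {δ : ℝ} {a b : Site 2} (hab : a ≠ b)
    (γ : DomainSAW Ω δ a b) : γ.curve.range ⊆ closure Ω := by
  have hd : ∀ d ∈ γ.walk.darts, segment ℝ (meshPoint δ d.fst) (meshPoint δ d.snd) ⊆ closure Ω :=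
    fun d _ => (meshGraph_adj_iff.1 (discreteDomainGraph_le_meshGraph Ω δ d.adj)).2
  obtain ⟨w, hw⟩ := γ
  cases w with
  | nil => exact absurd rfl hab
  | cons h q =>
    rintro _ ⟨t, rfl⟩
    refine walk_range_toCurve_subset (SimpleGraph.Walk.cons h q)
      ((meshGraph_adj_iff.1 (discreteDomainGraph_le_meshGraph Ω δ h)).2 (left_mem_segment ℝ _ _))
      hd ⟨t, rfl⟩

/-- Under the endpoint hypothesis the lattice endpoints are eventually DISTINCT along the sequence
(`δ·a δ → a ≠ b ← δ·b δ`, `MarkedDomain.pt_injective`). [folklore] -/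
theorem eventually_ne_of_hyps {D : DobrushinDomain} {a b : ℝ → Site 2} (hab : IsEndpointApprox D a b)
    {s : ℕ → ℝ} (hs : Tendsto s atTop (𝓝[>] (0 : ℝ))) : ∀ᶠ n in atTop, a (s n) ≠ b (s n) := by
  have hpt : D.pt 0 ≠ D.pt 1 := fun h => absurd (D.pt_injective h) (by decide)
  obtain ⟨U, V, hU, hV, h0, h1, hUV⟩ := t2_separation hpt
  have h0' : ∀ᶠ n in atTop, meshPoint (s n) (a (s n)) ∈ U :=
    (hab.tendsto_fst.comp hs) (hU.mem_nhds h0)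
  have h1' : ∀ᶠ n in atTop, meshPoint (s n) (b (s n)) ∈ V :=
    (hab.tendsto_snd.comp hs) (hV.mem_nhds h1)
  filter_upwards [h0', h1'] with n hn0 hn1 heq
  rw [heq] at hn0
  exact Set.disjoint_left.1 hUV hn0 hn1

/-- **Subsequential limits are supported on curves in `D̄`** (the third clause of
`IsSLELaw.ae_endpoints` is also automatic): the truncated distance to the closed nonempty set
`rangeSubset (closure D)` is a test function vanishing on every SAW curve between distinct
endpoints. [folklore] -/
theorem ae_range_subset_closure_of_hyps {D : DobrushinDomain} {a b : ℝ → Site 2}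
    (hab : IsEndpointApprox D a b) {s : ℕ → ℝ} (hs : Tendsto s atTop (𝓝[>] (0 : ℝ)))
    {μ : Measure (CurveClass ℂ)} [IsProbabilityMeasure μ]
    (hlim : ∀ f : CurveClass ℂ →ᵇ ℝ, Tendsto (fun n => ∫ γ, f γ.curve
      ∂(law D.carrier (s n) (a (s n)) (b (s n)))) atTop (𝓝 (∫ x, f x ∂μ))) :
    ∀ᵐ γ ∂μ, γ.range ⊆ closure D.carrier := by
  set F : Set (CurveClass ℂ) := CurveClass.rangeSubset (closure D.carrier) with hF
  have hFc : IsClosed F := CurveClass.isClosed_rangeSubset isClosed_closure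
  obtain ⟨z, hz⟩ := D.nonempty
  have hFne : F.Nonempty := by
    refine ⟨CurveClass.mk (Curve.const z), ?_⟩
    rw [hF, CurveClass.mem_rangeSubset, CurveClass.range_mk]
    rintro _ ⟨t, rfl⟩
    exact subset_closure hz
  -- test function: truncated distance to `F`
  set φ : CurveClass ℂ →ᵇ ℝ := BoundedContinuousFunction.mkOfBound
    ⟨fun γ => min 1 (Metric.infDist γ F), continuous_const.min (Metric.continuous_infDist_pt F)⟩ 1
    (fun γ γ' => by
      simp only [ContinuousMap.coe_mk, Real.dist_eq]
      have h1 : 0 ≤ min 1 (Metric.infDist γ F) := le_min zero_le_one Metric.infDist_nonneg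
      have h2 : min 1 (Metric.infDist γ F) ≤ 1 := min_le_left _ _
      have h3 : 0 ≤ min 1 (Metric.infDist γ' F) := le_min zero_le_one Metric.infDist_nonneg
      have h4 : min 1 (Metric.infDist γ' F) ≤ 1 := min_le_left _ _
      rw [abs_le]; constructor <;> linarith) with hφdef
  have hφ : ∀ γ, φ γ = min 1 (Metric.infDist γ F) := fun _ => rfl
  have hint0 : ∀ᶠ n in atTop, ∫ γ, φ γ.curve ∂(law D.carrier (s n) (a (s n)) (b (s n))) = 0 :=
    (eventually_ne_of_hyps hab hs).mono fun n hn => by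
      have : (fun γ : DomainSAW D.carrier (s n) (a (s n)) (b (s n)) => φ γ.curve) = fun _ => 0 :=
        funext fun γ => by
          have hmem : γ.curve ∈ F := by
            rw [hF, CurveClass.mem_rangeSubset]; exact range_curve_subset_closure hn γ
          rw [hφ, Metric.infDist_zero_of_mem hmem, min_eq_right zero_le_one]
      rw [this, integral_zero]
  have hlim0 : Tendsto (fun n => ∫ γ, φ γ.curve ∂(law D.carrier (s n) (a (s n)) (b (s n)))) atTop
      (𝓝 0) :=
    tendsto_const_nhds.congr' (hint0.mono fun n hn => hn.symm)
  have hint : ∫ x, φ x ∂μ = 0 := tendsto_nhds_unique (hlim φ) hlim0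
  have hae : (fun x => φ x) =ᵐ[μ] 0 :=
    (integral_eq_zero_iff_of_nonneg
      (fun x => show (0 : CurveClass ℂ → ℝ) x ≤ φ x from le_min zero_le_one Metric.infDist_nonneg)
      (φ.integrable μ)).1 hint
  filter_upwards [hae] with γ hγ
  have h0 : min 1 (Metric.infDist γ F) = 0 := by rw [← hφ]; exact hγ
  have hdist : Metric.infDist γ F = 0 := by
    rcases min_eq_iff.1 h0 with ⟨h, -⟩ | ⟨h, -⟩
    · exact absurd h one_ne_zero
    · exact h
  have hmem : γ ∈ F := (hFc.mem_iff_infDist_zero hFne).2 hdist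
  rw [hF, CurveClass.mem_rangeSubset] at hmem
  exact hmem

/-! ## §4 Verdict of cycle 1 and attack log -/

open Summit.CriticalPhenomena.SAWScalingLimit.Theses.SAWRenewalTightness in
/-- **VERDICT (cycle 1): the crux RESISTS every cheap attack; no refutation exists short of disproving
the Lawler–Schramm–Werner conjecture itself.** Formal content: the six load-bearing witnesses of §1–§2,
the redundancy of `IsProbabilityMeasure μ` (§1c) and the necessity `SAWScalingLimit → SubseqIdentification`
of §3. LOAD-BEARING TABLE: `IsEndpointApprox.reachable` — no (derivable along `s`);
`tendsto_fst` — YES; `tendsto_snd` — YES; `s n > 0` eventually — YES; `s n → 0` — YES;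
`IsProbabilityMeasure μ` — no (derivable); convergence for all `f ∈ C_b` — YES (trivially).

ATTACK LOG (what was tried, why it fails — for ideators/planners/provers):
1. *Typing / junk.* `CurveClass ℂ` is a genuine Polish metric space (separation quotient of the
   reparametrisation pseudometric), so bounded continuous test functions determine `μ`: no slack in the
   convergence hypothesis. `SAW.law = (Z)⁻¹ • weight` has mass `0` or `1` only (`law_univ_eq_zero_or_one`);
   the junk value `0` (no SAW between `a δ`, `b δ`) is incompatible with the `f ≡ 1` test integral tending
   to `1`, so along the sequence the laws ARE probability measures and the endpoints ARE joined
   (`eventually_isProbabilityMeasure_of_tendsto`, `eventually_reachable_of_tendsto`) — the junk regime is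
   unreachable under the hypotheses. `IsSLELaw (8/3) D` is inhabited for EVERY Dobrushin domain
   (`exists_isSLECurve_eightThirds`, proved in tree), so the conclusion is never unsatisfiable-by-typing.
2. *Degenerate endpoints.* Coincident endpoints `a δ = b δ` (law = Dirac at the trivial walk) are the
   only regime where the SAW law is computable; they are excluded for small `δ` because
   `δ·a δ → D.pt 0 ≠ D.pt 1 ← δ·b δ` (`MarkedDomain.pt_injective`). Adjacent endpoints with a unique SAW
   need a degree-one vertex, again forcing `dist (δ·a δ) (δ·b δ) = δ → 0`, contradiction. Dropping either
   endpoint limit makes the statement false (§1): the endpoint limits are exactly what excludes this.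
3. *Degenerate meshes.* Fixed or negative meshes make the law computable but are excluded by
   `Tendsto s atTop (𝓝[>] 0)` (§2 shows both exclusions are used).
4. *Degenerate domains.* For a FIXED open `Ω` every open ball inside it is resolved at small mesh, so the
   SAW from near `a` to near `b ≠ a` lives in a macroscopic 2D region and its critical law is spread over
   exponentially many walks — never explicitly computable, never concentrated near one curve. Thin
   features AT the marked points (inward cusps `|y| < g(x)`, fjords) force a deterministic initial segment
   only where the channel is one vertex wide, i.e. on `{g < δ}`, whose Euclidean extent → 0: invisible in
   the limit. Smirnov's "largest component" convention (`meshDomain`) cannot strand `a δ` in a spurious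
   component: any compact subset of `Ω` joins the main component for all small `δ`, whose cardinality
   then dominates. Zero-width slits are invisible to `meshGraph` (edges need only lie in `closure Ω`) but
   are not Jordan; positive-width notches are resolved. No domain makes a subsequential limit identifiable.
5. *Necessary conditions of the conclusion.* An SLE_{8/3} law a.s. starts at `a`, ends at `b`, stays in
   `D̄` (`IsSLELaw.ae_endpoints`), is simple and avoids `∂D` away from `a,b` (`IsSLELaw.ae_simple`, with
   its Rohde–Schramm input DISCHARGED in tree: see the sibling disprover's
   `Theorems/SimpleSubseqLimits/Negative/SimpleSubseqLimitsNecessary.lean`, `ae_carrier_of_isSLELaw`,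
   whence `SubseqIdentification → SimpleSubseqLimits` = `not_subseqIdentification_of_not_simpleSubseqLimits`
   there: a subsequential limit charging non-simple or boundary-touching curves would kill THIS crux), has no
   atoms, satisfies restriction and conformal covariance. The first group is AUTOMATIC for subsequential
   SAW limits (`ae_endpoints_of_hyps`, `ae_range_subset_closure_of_hyps`: PROVED here). Each of
   the others, if violated, would need a macroscopic estimate on critical `ℤ²` SAW that is itself open
   (non-simplicity of the limit = macroscopic self-touching = a 6-arm-type bound; boundary touching = a
   boundary 3-arm bound; an atom = concentration; failure of restriction/covariance = an identified
   non-conformal limit). Nothing of the kind is in print; numerics support SLE_{8/3} for the square lattice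
   (Kennedy's Monte Carlo tests of SLE_{8/3} predictions for the half-plane SAW, arXiv:math/0112246,
   arXiv:math/0207231) and the known lattice effects concern un-normalised boundary partition functions,
   not the normalised law (Kennedy–Lawler, "Lattice effects in the scaling limit of the two-dimensional
   self-avoiding walk", arXiv:1109.3091) [citations from memory; `lit search` was unavailable (searchd
   rc 75) during cycle 1 — to be re-verified].
6. *Necessity.* `subseqIdentification_of_sawScalingLimit`: the crux follows from the summit conjunct, so
   `¬ crux → ¬ SAWScalingLimit` (`not_sawScalingLimit_of_not_subseqIdentification`): a disproof of this
   crux would be a disproof of LSW's Prediction 1 as typed on `δℤ²` — major news, not a cheap kill.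
7. *Barrier remark for PROVERS (not a falsity argument).* The statement is embedding-sensitive: the same
   sentence for the sheared lattice `diag(1,p)ℤ²`, `p ≠ 1`, is expected FALSE (the limit would be the shear
   image of SLE_{8/3}, which is not an `IsSLELaw` of the sheared domain), so any proof must use the square
   symmetry of `ℤ² ⊂ ℂ` somewhere (Beffara 2008; `Literature.Barriers.CriticalPhenomena.EmbeddingModulusUniqueness`):
   embedding-blind inputs (sub-additivity, Kesten's bridges, RSW-type surgery, FKG-type correlation
   inequalities, tightness) cannot suffice. In print, identification is known only CONDITIONALLY on
   conformal covariance + restriction of the limit (LSW 2004, Prediction 1 / LSW 2003 restriction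
   characterisation), and no discrete holomorphic observable is available on `ℤ²`
   (`NienhuisWeightsExcludeVertexSAW`, `ParafermionicHalfCauchyRiemann` barriers).
NEXT REGIMES (cycle 2+): (i) [done in v4: `ae_range_subset_closure_of_hyps`]; (ii) tightness necessity `SAWScalingLimit → EventualTight` on `ℤ²`
(mirror of `ObservableToSLE/Negative/TightnessNecessity`), giving `SAWScalingLimit ↔ EventualTight ∧
SubseqIdentification` together with the route's `closes`; (iii) attack the lead's stubs once a line is
picked. [folklore] -/
theorem verdict_cycle1 :
    ¬ SubseqIdentificationWithoutEndpointApprox ∧ ¬ SubseqIdentificationWithoutEndpointLimits ∧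
    ¬ SubseqIdentificationWithoutSndLimit ∧ ¬ SubseqIdentificationWithoutFstLimit ∧
    ¬ SubseqIdentificationWithoutOneSided ∧ ¬ SubseqIdentificationWithoutMeshToZero ∧
    (SubseqIdentification ↔ SubseqIdentificationWithoutProb) ∧
    (SAW.SAWScalingLimit → SubseqIdentification) :=
  ⟨subseqIdentification_false_without_endpointApprox, subseqIdentification_false_without_endpointLimits,
    subseqIdentification_false_without_sndLimit, subseqIdentification_false_without_fstLimit,
    subseqIdentification_false_without_oneSided, subseqIdentification_false_without_meshToZero,
    subseqIdentification_iff_withoutProb, subseqIdentification_of_sawScalingLimit⟩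

/-! ## §5 (cycle 2) The reversibility debt

### §5.1 Time reversal of the self-avoiding walks of `Ω_δ ⊆ δℤ²` -/

section Lattice

variable {Ω : Set ℂ} {δ : ℝ} {a b : Site 2}

/-- Time reversal of a SAW of `Ω_δ` (the reversed walk is still self-avoiding). [folklore] -/
def sawReverse (γ : DomainSAW Ω δ a b) : DomainSAW Ω δ b a :=
  ⟨γ.walk.reverse, γ.isPath.reverse⟩

/-- The underlying walk of the reversed SAW. [folklore] -/
@[simp] theorem walk_sawReverse (γ : DomainSAW Ω δ a b) : (sawReverse γ).walk = γ.walk.reverse := rfl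

/-- Time reversal is an involution. [folklore] -/
@[simp] theorem sawReverse_sawReverse (γ : DomainSAW Ω δ a b) : sawReverse (sawReverse γ) = γ := by
  obtain ⟨w, hw⟩ := γ
  simp only [sawReverse, SimpleGraph.Walk.reverse_reverse]

/-- Time reversal as an equivalence `SAW(a → b) ≃ SAW(b → a)`. [folklore] -/
def sawReverseEquiv : DomainSAW Ω δ a b ≃ DomainSAW Ω δ b a where
  toFun := sawReverse
  invFun := sawReverse
  left_inv := sawReverse_sawReverse
  right_inv := sawReverse_sawReverse

@[simp] theorem sawReverseEquiv_apply (γ : DomainSAW Ω δ a b) : sawReverseEquiv γ = sawReverse γ := rfl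

/-- Time reversal as a measurable equivalence (discrete σ-algebras). [folklore] -/
def sawReverseMeasurableEquiv : DomainSAW Ω δ a b ≃ᵐ DomainSAW Ω δ b a where
  toEquiv := sawReverseEquiv
  measurable_toFun := DomainSAW.measurable_of_top _
  measurable_invFun := DomainSAW.measurable_of_top _

/-- Reversal preserves the number of steps `|γ|`. [folklore] -/
@[simp] theorem length_sawReverse (γ : DomainSAW Ω δ a b) : (sawReverse γ).length = γ.length := by
  simp [DomainSAW.length, sawReverse]

/-- **Reversing the walk reverses its curve class** (the polyline through the reversed vertex list
is the time reversal of the polyline modulo increasing reparametrisation,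
`reparamDist_polyline_reverse`). [folklore] -/
theorem curve_sawReverse (γ : DomainSAW Ω δ a b) :
    (sawReverse γ).curve = CurveClass.reverse γ.curve := by
  rw [DomainSAW.curve, DomainSAW.curve, CurveClass.reverse_mk, CurveClass.mk_eq_mk]
  simp only [walk_sawReverse, SimpleGraph.Walk.toCurve, SimpleGraph.Walk.support_reverse,
    List.map_reverse]
  exact Literature.Probability.Percolation.reparamDist_polyline_reverse _

/-- The critical SAW measure of a set: the sum of the weights `x_c^{|γ|}` over the set. [folklore] -/
theorem weight_apply_tsum (T : Set (DomainSAW Ω δ a b)) :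
    weight Ω δ a b T = ∑' γ : DomainSAW Ω δ a b,
      T.indicator (fun γ => ENNReal.ofReal (criticalFugacity ^ γ.length)) γ := by
  rw [weight, Measure.sum_apply _ MeasurableSpace.measurableSet_top]
  refine tsum_congr fun γ => ?_
  rw [Measure.smul_apply, smul_eq_mul, Measure.dirac_apply' _ MeasurableSpace.measurableSet_top]
  by_cases hγ : γ ∈ T
  · simp [hγ]
  · simp [hγ]

/-- **Exact reversal invariance of the critical weight** `γ ↦ x_c^{|γ|}` (LSW 2004 §3.1):
`(weight Ω δ a b).map sawReverse = weight Ω δ b a`. [folklore] -/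
theorem map_sawReverse_weight : (weight Ω δ a b).map sawReverse = weight Ω δ b a := by
  ext T -
  rw [Measure.map_apply (DomainSAW.measurable_of_top _) MeasurableSpace.measurableSet_top,
    weight_apply_tsum, weight_apply_tsum]
  rw [← (sawReverseEquiv (Ω := Ω) (δ := δ) (a := a) (b := b)).tsum_eq
    (fun γ' => T.indicator (fun γ' => ENNReal.ofReal (criticalFugacity ^ γ'.length)) γ')]
  refine tsum_congr fun γ => ?_
  simp only [sawReverseEquiv_apply, Set.indicator, length_sawReverse]
  rfl

/-- The total weights `Z_δ(a → b)` and `Z_δ(b → a)` agree. [folklore] -/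
theorem weight_univ_swap : weight Ω δ b a univ = weight Ω δ a b univ := by
  rw [← map_sawReverse_weight,
    Measure.map_apply (DomainSAW.measurable_of_top _) MeasurableSpace.measurableSet_top, preimage_univ]

/-- **Exact lattice reversibility of the critical SAW law** (every mesh, every pair of endpoints,
junk cases included): `(law Ω δ a b).map sawReverse = law Ω δ b a`. [folklore] -/
theorem map_sawReverse_law : (law Ω δ a b).map sawReverse = law Ω δ b a := by
  rw [law, law, Measure.map_smul, map_sawReverse_weight, weight_univ_swap]

/-- Integration against the `b → a` law is integration of the reversed observable against the
`a → b` law. [folklore] -/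
theorem integral_law_swap {F : Type*} [NormedAddCommGroup F] [NormedSpace ℝ F]
    (f : DomainSAW Ω δ b a → F) :
    ∫ γ, f γ ∂(law Ω δ b a) = ∫ γ, f (sawReverse γ) ∂(law Ω δ a b) := by
  rw [← map_sawReverse_law]
  exact integral_map_equiv (sawReverseMeasurableEquiv (Ω := Ω) (δ := δ) (a := a) (b := b)) f

/-- For every observable `f` of the curve class:
`∫ f(γ.curve) dP^{(b,a)}_δ = ∫ f(reverse γ.curve) dP^{(a,b)}_δ`. [folklore] -/
theorem integral_curve_law_swap {F : Type*} [NormedAddCommGroup F] [NormedSpace ℝ F]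
    (f : CurveClass ℂ → F) :
    ∫ γ, f γ.curve ∂(law Ω δ b a) = ∫ γ, f (CurveClass.reverse γ.curve) ∂(law Ω δ a b) := by
  rw [integral_law_swap]
  simp_rw [curve_sawReverse]

/-- The pushed-forward laws on curve space: `P^{(b,a)}_δ ∘ curve⁻¹ = reverse_* (P^{(a,b)}_δ ∘ curve⁻¹)`.
[folklore] -/
theorem map_curve_law_swap :
    (law Ω δ b a).map (fun γ => γ.curve) = ((law Ω δ a b).map (fun γ => γ.curve)).map CurveClass.reverse := by
  rw [Measure.map_map CurveClass.measurable_reverse (DomainSAW.measurable_of_top _),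
    ← map_sawReverse_law, Measure.map_map (DomainSAW.measurable_of_top _) (DomainSAW.measurable_of_top _)]
  congr 1
  funext γ
  simp [curve_sawReverse]

end Lattice

/-! ### §5.2 Endpoint approximations read backwards approximate the swapped domain -/

section Swap

variable {D : DobrushinDomain} {a b : ℝ → Site 2}

/-- An endpoint approximation of `(D; a, b)`, read backwards, is an endpoint approximation of
`D.swap = (D; b, a)` (same carrier, marked points exchanged). [folklore] -/
theorem isEndpointApprox_swap (h : IsEndpointApprox D a b) : IsEndpointApprox D.swap b a where
  reachable := h.reachable.mono fun δ hδ => hδ.symm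
  tendsto_fst := by
    rw [MarkedDomain.pt_swap_zero]
    exact h.tendsto_snd
  tendsto_snd := by
    rw [MarkedDomain.pt_swap_one]
    exact h.tendsto_fst

/-- … and conversely. [folklore] -/
theorem isEndpointApprox_of_swap (h : IsEndpointApprox D.swap b a) : IsEndpointApprox D a b where
  reachable := h.reachable.mono fun δ hδ => hδ.symm
  tendsto_fst := by
    rw [← MarkedDomain.pt_swap_one D]
    exact h.tendsto_snd
  tendsto_snd := by
    rw [← MarkedDomain.pt_swap_zero D]
    exact h.tendsto_fst

theorem isEndpointApprox_swap_iff : IsEndpointApprox D.swap b a ↔ IsEndpointApprox D a b :=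
  ⟨isEndpointApprox_of_swap, isEndpointApprox_swap⟩

end Swap

/-! ### §5.3 Subsequential limits reverse; the reversibility debt of the crux -/

section Debt

variable {D : DobrushinDomain} {a b : ℝ → Site 2} {s : ℕ → ℝ} {μ : Measure (CurveClass ℂ)}

/-- **Subsequential limits reverse.** If the `(a_δ → b_δ)` laws converge to `μ` along `s` (the
convergence hypothesis of the crux), the `(b_δ → a_δ)` laws converge to `μ.map reverse` along the
same `s` (lattice identity at each mesh + continuity of `reverse`). [folklore] -/
theorem tendsto_integral_swap {Ω : Set ℂ}
    (h : ∀ f : CurveClass ℂ →ᵇ ℝ, Tendsto (fun n => ∫ γ, f γ.curve ∂(law Ω (s n) (a (s n)) (b (s n))))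
      atTop (𝓝 (∫ x, f x ∂μ))) (f : CurveClass ℂ →ᵇ ℝ) :
    Tendsto (fun n => ∫ γ, f γ.curve ∂(law Ω (s n) (b (s n)) (a (s n)))) atTop
      (𝓝 (∫ x, f x ∂(μ.map CurveClass.reverse))) := by
  have hf := h (f.compContinuous ⟨CurveClass.reverse, CurveClass.continuous_reverse⟩)
  rw [integral_map CurveClass.measurable_reverse.aemeasurable f.continuous.aestronglyMeasurable]
  refine hf.congr fun n => ?_
  simp only [BoundedContinuousFunction.compContinuous_apply, ContinuousMap.coe_mk]
  exact (integral_curve_law_swap (fun c => f c)).symm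

/-- Reversal is an involution on limits too: convergence of the `(b,a)` laws towards
`μ.map reverse` is EQUIVALENT to convergence of the `(a,b)` laws towards `μ`. [folklore] -/
theorem tendsto_integral_swap_iff {Ω : Set ℂ} :
    (∀ f : CurveClass ℂ →ᵇ ℝ, Tendsto (fun n => ∫ γ, f γ.curve ∂(law Ω (s n) (b (s n)) (a (s n))))
      atTop (𝓝 (∫ x, f x ∂(μ.map CurveClass.reverse)))) ↔
    (∀ f : CurveClass ℂ →ᵇ ℝ, Tendsto (fun n => ∫ γ, f γ.curve ∂(law Ω (s n) (a (s n)) (b (s n))))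
      atTop (𝓝 (∫ x, f x ∂μ))) := by
  refine ⟨fun h => ?_, fun h => tendsto_integral_swap h⟩
  have h2 := tendsto_integral_swap h
  rwa [Measure.map_map CurveClass.measurable_reverse CurveClass.measurable_reverse,
    CurveClass.reverse_comp_reverse, Measure.map_id] at h2

open Summit.CriticalPhenomena.SAWScalingLimit.Theses.SAWRenewalTightness

/-- **THE REVERSIBILITY DEBT (pointwise).** Under the crux, every subsequential limit `μ` of the
`(a_δ → b_δ)` SAW laws in `D` is the SLE_{8/3} law of `(D; a, b)` AND its time reversal is the
SLE_{8/3} law of `(D; b, a)` — the crux is applied a second time to the reversed data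
(`isEndpointApprox_swap`, `tendsto_integral_swap`; `D.swap.carrier = D.carrier` by `rfl`). [folklore] -/
theorem isSLELaw_and_swap_of_subseqIdentification (h : SubseqIdentification)
    (hab : IsEndpointApprox D a b) (hs : Tendsto s atTop (𝓝[>] (0 : ℝ))) [IsProbabilityMeasure μ]
    (hlim : ∀ f : CurveClass ℂ →ᵇ ℝ, Tendsto (fun n => ∫ γ, f γ.curve
      ∂(law D.carrier (s n) (a (s n)) (b (s n)))) atTop (𝓝 (∫ x, f x ∂μ))) :
    IsSLELaw ((8 : ℝ≥0) / 3) D μ ∧ IsSLELaw ((8 : ℝ≥0) / 3) D.swap (μ.map CurveClass.reverse) :=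
  ⟨h D a b hab s μ hs inferInstance hlim,
    h D.swap b a (isEndpointApprox_swap hab) s _ hs inferInstance (tendsto_integral_swap hlim)⟩

/-- "`D` carries a subsequential SAW scaling limit" (the hypotheses of the crux are satisfiable on
`D`) is symmetric under exchanging the marked points. [folklore] -/
theorem hasSubseqLimit_swap
    (h : (∃ (a b : ℝ → Site 2) (s : ℕ → ℝ) (μ : Measure (CurveClass ℂ)), IsEndpointApprox D a b ∧
      Tendsto s atTop (𝓝[>] (0 : ℝ)) ∧ IsProbabilityMeasure μ ∧
      (∀ f : CurveClass ℂ →ᵇ ℝ, Tendsto (fun n => ∫ γ, f γ.curve ∂(law D.carrier (s n) (a (s n)) (b (s n)))) atTop (𝓝 (∫ x, f x ∂μ))))) :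
    (∃ (a b : ℝ → Site 2) (s : ℕ → ℝ) (μ : Measure (CurveClass ℂ)), IsEndpointApprox D.swap a b ∧
      Tendsto s atTop (𝓝[>] (0 : ℝ)) ∧ IsProbabilityMeasure μ ∧
      (∀ f : CurveClass ℂ →ᵇ ℝ, Tendsto (fun n => ∫ γ, f γ.curve ∂(law D.swap.carrier (s n) (a (s n)) (b (s n)))) atTop (𝓝 (∫ x, f x ∂μ)))) := by
  obtain ⟨a, b, s, μ, hab, hs, hμ, hlim⟩ := h
  exact ⟨b, a, s, μ.map CurveClass.reverse, isEndpointApprox_swap hab, hs, inferInstance,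
    tendsto_integral_swap hlim⟩

/-- **THE REVERSIBILITY DEBT (law level).** `SubseqIdentification` implies ZHAN'S REVERSIBILITY of
chordal SLE_{8/3} on every Dobrushin domain carrying a subsequential SAW scaling limit (hypothesis
`hD`: the hypotheses of the crux are satisfiable on `D`): the time reversal of ANY SLE_{8/3} law of
`(D; a, b)` is an SLE_{8/3} law of `(D; b, a)` (uniqueness in law, `IsSLELaw.unique'`, proved in
tree). Zhan, Ann. Probab. 36 (2008) (`κ ≤ 4`); for `κ = 8/3` also LSW 2003 via restriction. Not in
the tree: a proof of the crux must supply it. [folklore] -/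
theorem isSLELaw_swap_of_subseqIdentification (h : SubseqIdentification)
    (hD : (∃ (a b : ℝ → Site 2) (s : ℕ → ℝ) (μ : Measure (CurveClass ℂ)), IsEndpointApprox D a b ∧
      Tendsto s atTop (𝓝[>] (0 : ℝ)) ∧ IsProbabilityMeasure μ ∧
      (∀ f : CurveClass ℂ →ᵇ ℝ, Tendsto (fun n => ∫ γ, f γ.curve ∂(law D.carrier (s n) (a (s n)) (b (s n)))) atTop (𝓝 (∫ x, f x ∂μ)))))
    {ν : Measure (CurveClass ℂ)} (hν : IsSLELaw ((8 : ℝ≥0) / 3) D ν) :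
    IsSLELaw ((8 : ℝ≥0) / 3) D.swap (ν.map CurveClass.reverse) := by
  obtain ⟨a, b, s, μ, hab, hs, hμ, hlim⟩ := hD
  obtain ⟨h1, h2⟩ := isSLELaw_and_swap_of_subseqIdentification h hab hs hlim
  rwa [IsSLELaw.unique' hν h1]

/-- **Identification form**: under the crux, on such a domain EVERY SLE_{8/3} law of `(D; b, a)` is
the time reversal of EVERY SLE_{8/3} law of `(D; a, b)` — the clause `ChordalFamily.IsReversible`
asks of the SLE_{8/3} family. [folklore] -/
theorem sleLaw_swap_eq_map_reverse_of_subseqIdentification (h : SubseqIdentification)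
    (hD : (∃ (a b : ℝ → Site 2) (s : ℕ → ℝ) (μ : Measure (CurveClass ℂ)), IsEndpointApprox D a b ∧
      Tendsto s atTop (𝓝[>] (0 : ℝ)) ∧ IsProbabilityMeasure μ ∧
      (∀ f : CurveClass ℂ →ᵇ ℝ, Tendsto (fun n => ∫ γ, f γ.curve ∂(law D.carrier (s n) (a (s n)) (b (s n)))) atTop (𝓝 (∫ x, f x ∂μ)))))
    {ν ν' : Measure (CurveClass ℂ)} (hν : IsSLELaw ((8 : ℝ≥0) / 3) D ν)
    (hν' : IsSLELaw ((8 : ℝ≥0) / 3) D.swap ν') : ν' = ν.map CurveClass.reverse :=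
  IsSLELaw.unique' hν' (isSLELaw_swap_of_subseqIdentification h hD hν)

/-- The same with the roles exchanged (reversal is an involution). [folklore] -/
theorem sleLaw_eq_map_reverse_swap_of_subseqIdentification (h : SubseqIdentification)
    (hD : (∃ (a b : ℝ → Site 2) (s : ℕ → ℝ) (μ : Measure (CurveClass ℂ)), IsEndpointApprox D a b ∧
      Tendsto s atTop (𝓝[>] (0 : ℝ)) ∧ IsProbabilityMeasure μ ∧
      (∀ f : CurveClass ℂ →ᵇ ℝ, Tendsto (fun n => ∫ γ, f γ.curve ∂(law D.carrier (s n) (a (s n)) (b (s n)))) atTop (𝓝 (∫ x, f x ∂μ)))))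
    {ν ν' : Measure (CurveClass ℂ)} (hν : IsSLELaw ((8 : ℝ≥0) / 3) D ν)
    (hν' : IsSLELaw ((8 : ℝ≥0) / 3) D.swap ν') : ν = ν'.map CurveClass.reverse := by
  rw [sleLaw_swap_eq_map_reverse_of_subseqIdentification h hD hν hν',
    Measure.map_map CurveClass.measurable_reverse CurveClass.measurable_reverse,
    CurveClass.reverse_comp_reverse, Measure.map_id]

/-- **A.s. form of the debt**: under the crux, on such a domain an event of curve classes that is
SLE_{8/3}(D; a, b)-almost sure is, read backwards, SLE_{8/3}(D; b, a)-almost sure. [folklore] -/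
theorem ae_sle_swap_of_subseqIdentification (h : SubseqIdentification)
    (hD : (∃ (a b : ℝ → Site 2) (s : ℕ → ℝ) (μ : Measure (CurveClass ℂ)), IsEndpointApprox D a b ∧
      Tendsto s atTop (𝓝[>] (0 : ℝ)) ∧ IsProbabilityMeasure μ ∧
      (∀ f : CurveClass ℂ →ᵇ ℝ, Tendsto (fun n => ∫ γ, f γ.curve ∂(law D.carrier (s n) (a (s n)) (b (s n)))) atTop (𝓝 (∫ x, f x ∂μ)))))
    {ν ν' : Measure (CurveClass ℂ)} (hν : IsSLELaw ((8 : ℝ≥0) / 3) D ν)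
    (hν' : IsSLELaw ((8 : ℝ≥0) / 3) D.swap ν') {p : CurveClass ℂ → Prop}
    (hp : ∀ᵐ c ∂ν, p c) : ∀ᵐ c ∂ν', p c.reverse := by
  rw [sleLaw_swap_eq_map_reverse_of_subseqIdentification h hD hν hν']
  exact CurveClass.ae_map_reverse_iff.2 (by simpa using hp)

end Debt

/-! ### §5.4 Where the debt is due: non-vacuity of the crux = one tight subsequence -/

section NonVacuity

variable {D : DobrushinDomain} {a b : ℝ → Site 2}

open Summit.CriticalPhenomena.SAWScalingLimit.Theses.SAWRenewalTightness

/-- **Prokhorov along the mesh for the SAW laws.** If the pushed-forward critical SAW laws of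
`(D; a_δ, b_δ)` are tight along `δ → 0⁺` (`IsTightAlongMesh`), then along every mesh sequence
`s → 0⁺` a subsequence converges to a probability measure: the hypotheses of the crux are then
satisfiable. (The laws are probability measures only eventually; we shift past the junk meshes
using `eventually_isProbabilityMeasure_law`.) [folklore] -/
theorem exists_subseqConv_of_isTightAlongMesh (hab : IsEndpointApprox D a b)
    (hT : IsTightAlongMesh (fun δ (γ : DomainSAW D.carrier δ (a δ) (b δ)) => γ.curve)
      (fun δ => law D.carrier δ (a δ) (b δ)))
    {s : ℕ → ℝ} (hs : Tendsto s atTop (𝓝[>] (0 : ℝ))) :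
    ∃ (φ : ℕ → ℕ) (μ : Measure (CurveClass ℂ)), StrictMono φ ∧ IsProbabilityMeasure μ ∧
      ∀ f : CurveClass ℂ →ᵇ ℝ, Tendsto (fun n => ∫ γ, f γ.curve
        ∂(law D.carrier (s (φ n)) (a (s (φ n))) (b (s (φ n))))) atTop (𝓝 (∫ x, f x ∂μ)) := by
  -- past some index the laws are probability measures
  obtain ⟨N, hN⟩ := eventually_atTop.1 (hs.eventually (eventually_isProbabilityMeasure_law hab))
  have hN' : ∀ n, IsProbabilityMeasure (law D.carrier (s (n + N)) (a (s (n + N))) (b (s (n + N)))) :=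
    fun n => hN _ (N.le_add_left n)
  let ν : ℕ → ProbabilityMeasure (CurveClass ℂ) := fun n =>
    ⟨(law D.carrier (s (n + N)) (a (s (n + N))) (b (s (n + N)))).map (fun γ => γ.curve),
      Measure.isProbabilityMeasure_map (DomainSAW.measurable_of_top _).aemeasurable⟩
  have hνapply : ∀ n (K : Set (CurveClass ℂ)), IsClosed K → (ν n : Measure (CurveClass ℂ)) Kᶜ =
      law D.carrier (s (n + N)) (a (s (n + N))) (b (s (n + N))) ((fun γ => γ.curve) ⁻¹' Kᶜ) :=
    fun n K hK => Measure.map_apply (DomainSAW.measurable_of_top _) hK.isOpen_compl.measurableSet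
  have htight : IsTightMeasureSet
      {((μ : ProbabilityMeasure (CurveClass ℂ)) : Measure (CurveClass ℂ)) | μ ∈ Set.range ν} := by
    have hrange : {((μ : ProbabilityMeasure (CurveClass ℂ)) : Measure (CurveClass ℂ)) | μ ∈ Set.range ν}
        = Set.range (fun n => (ν n : Measure (CurveClass ℂ))) := by
      ext x
      simp only [Set.mem_range, Set.mem_setOf_eq]
      constructor
      · rintro ⟨μ, ⟨n, rfl⟩, rfl⟩
        exact ⟨n, rfl⟩
      · rintro ⟨n, rfl⟩
        exact ⟨ν n, ⟨n, rfl⟩, rfl⟩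
    rw [hrange]
    haveI : ∀ n, IsFiniteMeasure ((fun n => (ν n : Measure (CurveClass ℂ))) n) := fun n => by
      change IsFiniteMeasure (ν n : Measure (CurveClass ℂ))
      infer_instance
    refine isTightMeasureSet_range_of_eventually fun ε hε => ?_
    obtain ⟨K, hK, hev⟩ := hT ε hε
    refine ⟨K, hK, ?_⟩
    have hs' : Tendsto (fun n => s (n + N)) atTop (𝓝[>] (0 : ℝ)) := hs.comp (tendsto_add_atTop_nat N)
    filter_upwards [hs'.eventually hev] with n hn
    rwa [hνapply n K hK.isClosed]
  have hcomp := isCompact_closure_of_isTightMeasureSet htight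
  obtain ⟨μ, -, φ, hφ, hlim⟩ := hcomp.isSeqCompact fun n => subset_closure (Set.mem_range_self n)
  refine ⟨fun n => φ n + N, μ, fun m n hmn => Nat.add_lt_add_right (hφ hmn) N, inferInstance,
    fun f => ?_⟩
  have := (ProbabilityMeasure.tendsto_iff_forall_integral_tendsto.1 hlim) f
  refine this.congr fun n => ?_
  change ∫ x, f x ∂((law D.carrier (s (φ n + N)) (a (s (φ n + N))) (b (s (φ n + N)))).map
    (fun γ => γ.curve)) = _
  exact integral_map (DomainSAW.measurable_of_top _).aemeasurable f.continuous.aestronglyMeasurable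

/-- Tightness of the SAW laws of one Dobrushin domain with one endpoint approximation makes the
crux NON-VACUOUS there (its hypotheses are satisfiable on `D`). [folklore] -/
theorem hasSubseqLimit_of_isTightAlongMesh (hab : IsEndpointApprox D a b)
    (hT : IsTightAlongMesh (fun δ (γ : DomainSAW D.carrier δ (a δ) (b δ)) => γ.curve)
      (fun δ => law D.carrier δ (a δ) (b δ))) :
    (∃ (a b : ℝ → Site 2) (s : ℕ → ℝ) (μ : Measure (CurveClass ℂ)), IsEndpointApprox D a b ∧
      Tendsto s atTop (𝓝[>] (0 : ℝ)) ∧ IsProbabilityMeasure μ ∧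
      (∀ f : CurveClass ℂ →ᵇ ℝ, Tendsto (fun n => ∫ γ, f γ.curve ∂(law D.carrier (s n) (a (s n)) (b (s n)))) atTop (𝓝 (∫ x, f x ∂μ)))) := by
  have hs : Tendsto (fun n : ℕ => 1 / ((n : ℝ) + 1)) atTop (𝓝[>] (0 : ℝ)) :=
    tendsto_nhdsWithin_iff.2 ⟨tendsto_one_div_add_atTop_nhds_zero_nat,
      Eventually.of_forall fun n => Set.mem_Ioi.2 Nat.one_div_pos_of_nat⟩
  obtain ⟨φ, μ, hφ, hμ, hlim⟩ := exists_subseqConv_of_isTightAlongMesh hab hT hs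
  exact ⟨a, b, _, μ, hab, hs.comp hφ.tendsto_atTop, hμ, hlim⟩

/-- The route's `EventualTight` (item stmt-CriticalPhenomena-1372, set-level tightness on an
initial mesh interval) gives tightness along the mesh for every endpoint approximation. [folklore] -/
theorem isTightAlongMesh_of_eventualTight (hT : EventualTight) (hab : IsEndpointApprox D a b) :
    IsTightAlongMesh (fun δ (γ : DomainSAW D.carrier δ (a δ) (b δ)) => γ.curve)
      (fun δ => law D.carrier δ (a δ) (b δ)) := by
  obtain ⟨δ₀, hδ₀, h⟩ := hT D a b hab
  exact isTightAlongMesh_of_isTightMeasureSet_image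
    (Eventually.of_forall fun δ => (DomainSAW.measurable_of_top _).aemeasurable) hδ₀ h

/-- Under `EventualTight`, every Dobrushin domain with an endpoint approximation carries a
subsequential SAW limit, so the reversibility debt of §3 is due on all of them. [folklore] -/
theorem hasSubseqLimit_of_eventualTight (hT : EventualTight) (hab : IsEndpointApprox D a b) :
    (∃ (a b : ℝ → Site 2) (s : ℕ → ℝ) (μ : Measure (CurveClass ℂ)), IsEndpointApprox D a b ∧
      Tendsto s atTop (𝓝[>] (0 : ℝ)) ∧ IsProbabilityMeasure μ ∧
      (∀ f : CurveClass ℂ →ᵇ ℝ, Tendsto (fun n => ∫ γ, f γ.curve ∂(law D.carrier (s n) (a (s n)) (b (s n)))) atTop (𝓝 (∫ x, f x ∂μ)))) :=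
  hasSubseqLimit_of_isTightAlongMesh hab (isTightAlongMesh_of_eventualTight hT hab)

/-- **The route's `X = EventualTight ∧ SubseqIdentification` proves Zhan's theorem at `κ = 8/3`**
on every Dobrushin domain admitting an endpoint approximation: the time reversal of the SLE_{8/3}
law of `(D; a, b)` is the SLE_{8/3} law of `(D; b, a)`. [folklore] -/
theorem isSLELaw_swap_of_eventualTight_of_subseqIdentification (hT : EventualTight)
    (h : SubseqIdentification) (hab : IsEndpointApprox D a b) {ν : Measure (CurveClass ℂ)}
    (hν : IsSLELaw ((8 : ℝ≥0) / 3) D ν) :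
    IsSLELaw ((8 : ℝ≥0) / 3) D.swap (ν.map CurveClass.reverse) :=
  isSLELaw_swap_of_subseqIdentification h (hasSubseqLimit_of_eventualTight hT hab) hν

/-- Unconditional instance of the previous statement on the unit disc `(𝔻; 1, -1)`, which carries
the honest endpoint approximation `isEndpointApprox_std`. [folklore] -/
theorem isSLELaw_swap_unitDisc_of_eventualTight_of_subseqIdentification (hT : EventualTight)
    (h : SubseqIdentification) {ν : Measure (CurveClass ℂ)}
    (hν : IsSLELaw ((8 : ℝ≥0) / 3) DobrushinDomain.unitDisc ν) :
    IsSLELaw ((8 : ℝ≥0) / 3) DobrushinDomain.unitDisc.swap (ν.map CurveClass.reverse) :=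
  isSLELaw_swap_of_eventualTight_of_subseqIdentification hT h isEndpointApprox_std hν

/-- **Non-vacuity status (remark with trivial formal content).** The hypotheses of the crux are
satisfiable on `D` iff some endpoint approximation has ONE weakly convergent mesh sequence; a
convergent sequence of probability measures on the Polish space `CurveClass ℂ` is tight, and
conversely one tight sequence yields a convergent subsequence (`exists_subseqConv_of_isTightAlongMesh`
is the filter version). No Dobrushin domain is currently KNOWN to carry such a limit (tightness of
the critical `ℤ²` SAW along a single sequence is open), so the crux cannot at present be tested on
one instance: it is non-vacuous exactly where the companion item `EventualTight` (or a sequential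
weakening of it) holds. Formal content recorded: under `EventualTight` the unit disc carries a
subsequential limit. [folklore] -/
theorem hasSubseqLimit_unitDisc_of_eventualTight (hT : EventualTight) :
    (∃ (a b : ℝ → Site 2) (s : ℕ → ℝ) (μ : Measure (CurveClass ℂ)), IsEndpointApprox DobrushinDomain.unitDisc a b ∧
      Tendsto s atTop (𝓝[>] (0 : ℝ)) ∧ IsProbabilityMeasure μ ∧
      (∀ f : CurveClass ℂ →ᵇ ℝ, Tendsto (fun n => ∫ γ, f γ.curve ∂(law DobrushinDomain.unitDisc.carrier (s n) (a (s n)) (b (s n)))) atTop (𝓝 (∫ x, f x ∂μ)))) :=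
  hasSubseqLimit_of_eventualTight hT isEndpointApprox_std

end NonVacuity


/-! ## §6 (cycle 2) Tightness is necessary: `SAWScalingLimit ↔ EventualTight ∧ SubseqIdentification`

### §6.1 A compact container for all SAW curve classes at meshes bounded below -/

section Container

/-- `δ·x = δ · (1·x)`. [folklore] -/
theorem meshPoint_eq_mul_one (δ : ℝ) (x : Site 2) : meshPoint δ x = (δ : ℂ) * meshPoint 1 x := by
  simp [meshPoint]

/-- The curve of a SAW of `Ω_δ ⊆ δℤ²` is the class of the rescaled polyline through its support.
[folklore] -/
theorem curve_eq_mk_polyline_zd {Ω : Set ℂ} {δ : ℝ} {u v : Site 2} (γ : DomainSAW Ω δ u v) :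
    γ.curve = CurveClass.mk ⟨polyline (γ.walk.support.map (meshPoint δ))⟩ :=
  rfl

/-- The rescaled polyline of a fixed vertex list moves Lipschitz-continuously with the mesh.
[folklore] -/
theorem dist_mk_polyline_zd_le (δ δ' : ℝ) (l : List (Site 2)) :
    dist (CurveClass.mk ⟨polyline (l.map (meshPoint δ))⟩)
        (CurveClass.mk ⟨polyline (l.map (meshPoint δ'))⟩) ≤
      dist δ δ' * ∑ v ∈ l.toFinset, ‖meshPoint 1 v‖ := by
  rw [CurveClass.dist_mk_mk]
  refine (Curve.dist_le_dist_toContinuousMap _ _).trans ?_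
  refine Summit.CriticalPhenomena.SAWScalingLimit.Theorems.ObservableToSLE.Negative.dist_polyline_map_le _ _ (by positivity) l fun v hv => ?_
  rw [meshPoint_eq_mul_one δ, meshPoint_eq_mul_one δ', dist_eq_norm, ← sub_mul, norm_mul,
    ← dist_eq_norm, Complex.dist_eq, ← Complex.ofReal_sub, Complex.norm_real, Real.norm_eq_abs,
    ← Real.dist_eq]
  refine mul_le_mul_of_nonneg_left ?_ dist_nonneg
  exact Finset.single_le_sum (f := fun v => ‖meshPoint 1 v‖) (fun _ _ => norm_nonneg _)
    (List.mem_toFinset.2 hv)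

/-- Continuity of the rescaled polyline in the mesh. [folklore] -/
theorem continuous_mk_polyline_zd (l : List (Site 2)) :
    Continuous fun δ : ℝ => CurveClass.mk ⟨polyline (l.map (meshPoint δ))⟩ := by
  set M : ℝ := ∑ v ∈ l.toFinset, ‖meshPoint 1 v‖ with hM
  have hM0 : 0 ≤ M := Finset.sum_nonneg fun _ _ => norm_nonneg _
  refine Metric.continuous_iff.2 fun δ ε hε => ⟨ε / (M + 1), by positivity, fun δ' hδ' => ?_⟩
  calc dist (CurveClass.mk ⟨polyline (l.map (meshPoint δ'))⟩)
        (CurveClass.mk ⟨polyline (l.map (meshPoint δ))⟩)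
        ≤ dist δ' δ * M := dist_mk_polyline_zd_le δ' δ l
    _ ≤ ε / (M + 1) * M := mul_le_mul_of_nonneg_right hδ'.le hM0
    _ < ε := by
        rw [div_mul_eq_mul_div, div_lt_iff₀ (by positivity)]
        nlinarith

/-- For meshes in `[lo, ∞)`, `0 < lo`, the mesh vertices of a bounded domain lie in one finite
set of sites (the sites of the ball of radius `R / lo` at mesh `1`). [folklore] -/
theorem exists_finite_superset_meshVertices {Ω : Set ℂ} (hΩ : Bornology.IsBounded Ω) {lo : ℝ}
    (hlo : 0 < lo) :
    ∃ S : Set (Site 2), S.Finite ∧ ∀ δ, lo ≤ δ → meshVertices Ω δ ⊆ S := by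
  obtain ⟨R, hR⟩ := hΩ.subset_ball 0
  refine ⟨meshVertices (Metric.ball (0 : ℂ) (R / lo)) 1,
    meshVertices_finite Metric.isBounded_ball one_pos, fun δ hδ v hv => ?_⟩
  have hδ0 : 0 < δ := hlo.trans_le hδ
  have h := hR hv
  rw [Metric.mem_ball, dist_zero_right, meshPoint_eq_mul_one, norm_mul, Complex.norm_real,
    Real.norm_eq_abs, abs_of_pos hδ0] at h
  rw [mem_meshVertices_iff, Metric.mem_ball, dist_zero_right, lt_div_iff₀ hlo]
  calc ‖meshPoint 1 v‖ * lo ≤ ‖meshPoint 1 v‖ * δ := mul_le_mul_of_nonneg_left hδ (norm_nonneg _)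
    _ = δ * ‖meshPoint 1 v‖ := mul_comm _ _
    _ < R := h

/-- Every vertex of a NONTRIVIAL walk of `Ω_δ` lies in the discrete domain `meshDomain Ω δ`
(both ends of every edge of `Ω_δ` do). [folklore] -/
theorem mem_meshDomain_of_mem_support {Ω : Set ℂ} {δ : ℝ} :
    ∀ {u v : Site 2} (p : (discreteDomainGraph Ω δ).Walk u v), p.length ≠ 0 →
      ∀ {w : Site 2}, w ∈ p.support → w ∈ meshDomain Ω δ := by
  intro u v p
  induction p with
  | nil => intro h; exact absurd rfl h
  | @cons x y z hadj p' ih =>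
    intro _ w hw
    rw [SimpleGraph.Walk.support_cons, List.mem_cons] at hw
    rcases hw with rfl | hw
    · exact (discreteDomainGraph_adj_iff.1 hadj).2.1
    · by_cases hp' : p'.length = 0
      · have hnil := SimpleGraph.Walk.eq_of_length_eq_zero hp'
        subst hnil
        have : w = y := by
          have := SimpleGraph.Walk.length_eq_zero_iff.1 hp'
          rw [SimpleGraph.Walk.nil_iff_support_eq] at this
          rw [this] at hw
          simpa using hw
        subst this
        exact (discreteDomainGraph_adj_iff.1 hadj).2.2
      · exact ih hp' hw

/-- Every vertex of a walk of `Ω_δ` between DISTINCT vertices is a mesh vertex of `Ω`. [folklore] -/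
theorem mem_meshVertices_of_mem_support_zd {Ω : Set ℂ} {δ : ℝ} {u v : Site 2} (huv : u ≠ v)
    (p : (discreteDomainGraph Ω δ).Walk u v) {w : Site 2} (hw : w ∈ p.support) :
    w ∈ meshVertices Ω δ := by
  refine meshDomain_subset_meshVertices Ω δ (mem_meshDomain_of_mem_support p ?_ hw)
  intro h0
  exact huv (SimpleGraph.Walk.eq_of_length_eq_zero h0)

/-- COMPACT CONTAINER: for meshes in a compact interval `[lo, hi] ⊆ (0, ∞)` all curve classes of
all nontrivial SAWs of `Ω_δ ⊆ δℤ²`, `Ω` bounded, lie in ONE compact subset of `CurveClass ℂ`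
(finitely many combinatorial supports, each moving continuously with the mesh). [folklore] -/
theorem exists_isCompact_forall_curve_mem_zd {Ω : Set ℂ} (hΩ : Bornology.IsBounded Ω) {lo hi : ℝ}
    (hlo : 0 < lo) :
    ∃ C : Set (CurveClass ℂ), IsCompact C ∧ ∀ δ ∈ Set.Icc lo hi, ∀ (u v : Site 2), u ≠ v →
      ∀ γ : DomainSAW Ω δ u v, γ.curve ∈ C := by
  obtain ⟨S, hS, hsub⟩ := exists_finite_superset_meshVertices hΩ hlo
  set L : Set (List (Site 2)) := {l | l.Nodup ∧ ∀ x ∈ l, x ∈ S} with hL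
  have hLfin : L.Finite := Literature.Probability.Percolation.finite_setOf_nodup_subset hS
  refine ⟨⋃ l ∈ L, (fun δ : ℝ => CurveClass.mk ⟨polyline (l.map (meshPoint δ))⟩) '' Set.Icc lo hi,
    hLfin.isCompact_biUnion fun l _ => isCompact_Icc.image (continuous_mk_polyline_zd l), ?_⟩
  intro δ hδ u v huv γ
  rw [curve_eq_mk_polyline_zd]
  refine Set.mem_biUnion (x := γ.walk.support) ⟨γ.isPath.support_nodup, fun x hx => ?_⟩
    ⟨δ, hδ, rfl⟩
  exact hsub δ hδ.1 (mem_meshVertices_of_mem_support_zd huv γ.walk hx)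

end Container

/-! ### §6.2 Tightness on an initial mesh interval is NECESSARY for convergence in law -/

section Necessity

variable {κ : ℝ≥0} {D : DobrushinDomain} {a b : ℝ → Site 2}

/-- Outside the open `η`-thickening of a nonempty set the distance to it is at least `η`. [folklore] -/
theorem le_infDist_of_not_mem_thickening_zd {X : Type*} [PseudoMetricSpace X] {K : Set X}
    (hK : K.Nonempty) {η : ℝ} {x : X} (hx : x ∈ (Metric.thickening η K)ᶜ) :
    η ≤ Metric.infDist x K := by
  by_contra h
  exact hx ((Metric.mem_thickening_iff_infDist_lt hK).2 (not_le.1 h))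

/-- **TIGHTNESS IS NECESSARY (set form, fixed `δ₀`).** If the critical `δℤ²` SAW curve classes of
`(D; a_δ, b_δ)` (an endpoint approximation) converge in law to chordal SLE_κ, then for some
`δ₀ > 0` the pushed-forward laws `{(P_δ).map curve : δ ∈ (0, δ₀]}` form a tight set of measures —
literally the clause of `EventualTight`. Ingredients: Ulam tightness of the limit law on the Polish
space `CurveClass ℂ`; one Urysohn test function per scale `1/(k+1)`; compact containers for the
meshes in `[Θ_{k+1}, δ₀]`; a closed, totally bounded diagonal intersection. [folklore] -/
theorem exists_isTightMeasureSet_image_of_convergesInLawToSLE (hab : IsEndpointApprox D a b)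
    (h : ConvergesInLawToSLE κ D (fun δ (γ : DomainSAW D.carrier δ (a δ) (b δ)) => γ.curve)
      (fun δ => law D.carrier δ (a δ) (b δ))) :
    ∃ δ₀ : ℝ, 0 < δ₀ ∧ IsTightMeasureSet
      ((fun δ => (law D.carrier δ (a δ) (b δ)).map (fun γ => γ.curve)) '' Set.Ioc 0 δ₀) := by
  classical
  obtain ⟨Γ, hΓ, -, hT⟩ := h
  haveI := isProbabilityMeasure_preWienerMeasure'
  set μ : Measure (CurveClass ℂ) := Process.preWienerMeasure.map Γ with hμ
  haveI hμP : IsProbabilityMeasure μ := Measure.isProbabilityMeasure_map hΓ.aemeasurable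
  -- good meshes: probability laws and distinct endpoints, on a fixed interval `(0, δ₁)`
  have hgood : ∀ᶠ δ in 𝓝[>] (0 : ℝ),
      IsProbabilityMeasure (law D.carrier δ (a δ) (b δ)) ∧ a δ ≠ b δ := by
    refine (eventually_isProbabilityMeasure_law hab).and ?_
    have hne : D.pt 0 ≠ D.pt 1 := fun h => absurd (D.pt_injective h) (by decide)
    obtain ⟨U, V, hU, hV, h0U, h1V, hUV⟩ := t2_separation hne
    filter_upwards [hab.tendsto_fst (hU.mem_nhds h0U), hab.tendsto_snd (hV.mem_nhds h1V)]
      with δ h0 h1 heq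
    have h0' : meshPoint δ (b δ) ∈ U := by rw [← heq]; exact h0
    exact Set.disjoint_left.1 hUV h0' h1
  obtain ⟨δ₁, hδ₁, hδ₁sub⟩ := mem_nhdsGT_iff_exists_Ioo_subset.1 hgood
  set δ₀ : ℝ := δ₁ / 2 with hδ₀
  have hδ₀pos : 0 < δ₀ := by rw [hδ₀]; exact half_pos hδ₁
  have hδ₀lt : δ₀ < δ₁ := by rw [hδ₀]; exact half_lt_self hδ₁
  have hgood' : ∀ δ ∈ Set.Ioc (0 : ℝ) δ₀,
      IsProbabilityMeasure (law D.carrier δ (a δ) (b δ)) ∧ a δ ≠ b δ :=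
    fun δ hδ => hδ₁sub ⟨hδ.1, hδ.2.trans_lt hδ₀lt⟩
  refine ⟨δ₀, hδ₀pos, ?_⟩
  rw [isTightMeasureSet_iff_exists_isCompact_measure_compl_le]
  intro ε hε
  rcases eq_or_ne ε ⊤ with rfl | hεtop
  · exact ⟨∅, isCompact_empty, fun _ _ => le_top⟩
  set e : ℝ := ε.toReal with he
  have he0 : 0 < e := ENNReal.toReal_pos hε.ne' hεtop
  -- per-level data: compact K_k (nonempty), threshold θ_k
  have hlevel : ∀ k : ℕ, ∃ K : Set (CurveClass ℂ), IsCompact K ∧ K.Nonempty ∧ ∃ θ : ℝ, 0 < θ ∧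
      ∀ δ ∈ Set.Ioo (0 : ℝ) θ, IsProbabilityMeasure (law D.carrier δ (a δ) (b δ)) ∧
        law D.carrier δ (a δ) (b δ)
            ((fun γ : DomainSAW D.carrier δ (a δ) (b δ) => γ.curve) ⁻¹'
              (Metric.thickening (1 / ((k : ℝ) + 1)) K)ᶜ) ≤ ENNReal.ofReal (e / 2 / 2 ^ k) := by
    intro k
    set ek : ℝ := e / 2 / 2 ^ k with hek_def
    have hek : 0 < ek := by positivity
    obtain ⟨K0, hK0c, hK0⟩ := (isTightMeasureSet_iff_exists_isCompact_measure_compl_le.1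
      (isTightMeasureSet_singleton (μ := μ))) (ENNReal.ofReal (ek / 2))
      (ENNReal.ofReal_pos.2 (by positivity))
    have hμK0 : μ K0ᶜ ≤ ENNReal.ofReal (ek / 2) := hK0 μ rfl
    set c₀ : CurveClass ℂ := CurveClass.mk (Curve.const 0)
    set K1 : Set (CurveClass ℂ) := insert c₀ K0 with hK1
    have hK1c : IsCompact K1 := hK0c.insert c₀
    have hK1ne : K1.Nonempty := ⟨c₀, Set.mem_insert _ _⟩
    have hμK1 : μ K1ᶜ ≤ ENNReal.ofReal (ek / 2) :=
      (measure_mono (Set.compl_subset_compl.2 (Set.subset_insert _ _))).trans hμK0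
    have hη : (0 : ℝ) < 1 / ((k : ℝ) + 1) := by positivity
    obtain ⟨g, hg0, hg1, hgK, hgF⟩ := Summit.CriticalPhenomena.SAWScalingLimit.Theorems.ObservableToSLE.Negative.exists_urysohn_infDist K1 hη
    have hlim : ∫ x, g x ∂μ < ek := by
      refine (Summit.CriticalPhenomena.SAWScalingLimit.Theorems.ObservableToSLE.Negative.integral_urysohn_le hK1c.isClosed hg1 hgK).trans_lt ?_
      rw [measureReal_def]
      have : (μ K1ᶜ).toReal ≤ ek / 2 := ENNReal.toReal_le_of_le_ofReal (by positivity) hμK1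
      linarith
    have ht := hT g
    have hint_eq : ∫ ω, g (Γ ω) ∂Process.preWienerMeasure = ∫ x, g x ∂μ :=
      (integral_map hΓ.aemeasurable g.continuous.aestronglyMeasurable).symm
    rw [hint_eq] at ht
    have hev : ∀ᶠ δ in 𝓝[>] (0 : ℝ),
        ∫ γ, g ((fun γ : DomainSAW D.carrier δ (a δ) (b δ) => γ.curve) γ)
          ∂law D.carrier δ (a δ) (b δ) < ek :=
      ht.eventually (Iio_mem_nhds hlim)
    obtain ⟨θ, hθ, hθsub⟩ := mem_nhdsGT_iff_exists_Ioo_subset.1 (hev.and hgood)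
    refine ⟨K1, hK1c, hK1ne, θ, hθ, fun δ hδ => ?_⟩
    obtain ⟨hint, hg'⟩ := hθsub hδ
    refine ⟨hg'.1, ?_⟩
    haveI := hg'.1
    have hF : MeasurableSet (Metric.thickening (1 / ((k : ℝ) + 1)) K1)ᶜ :=
      Metric.isOpen_thickening.measurableSet.compl
    have h1 : (law D.carrier δ (a δ) (b δ)).real
        ((fun γ : DomainSAW D.carrier δ (a δ) (b δ) => γ.curve) ⁻¹'
          (Metric.thickening (1 / ((k : ℝ) + 1)) K1)ᶜ) ≤
        ∫ γ, g ((fun γ : DomainSAW D.carrier δ (a δ) (b δ) => γ.curve) γ)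
          ∂law D.carrier δ (a δ) (b δ) :=
      Summit.CriticalPhenomena.SAWScalingLimit.Theorems.ObservableToSLE.Negative.measureReal_preimage_le_integral (DomainSAW.measurable_of_top _) hF
        hg0 fun x hx => hgF x (le_infDist_of_not_mem_thickening_zd hK1ne hx)
    calc law D.carrier δ (a δ) (b δ)
          ((fun γ : DomainSAW D.carrier δ (a δ) (b δ) => γ.curve) ⁻¹'
            (Metric.thickening (1 / ((k : ℝ) + 1)) K1)ᶜ)
        = ENNReal.ofReal ((law D.carrier δ (a δ) (b δ)).real
            ((fun γ : DomainSAW D.carrier δ (a δ) (b δ) => γ.curve) ⁻¹'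
              (Metric.thickening (1 / ((k : ℝ) + 1)) K1)ᶜ)) :=
          (ENNReal.ofReal_toReal (measure_ne_top _ _)).symm
      _ ≤ ENNReal.ofReal ek := ENNReal.ofReal_le_ofReal (h1.trans hint.le)
  choose K hKc hKne θ hθ hKθ using hlevel
  -- antitone positive thresholds `Θ k = min_{j ≤ k} θ j`
  set Θ : ℕ → ℝ := fun k => (Finset.range (k + 1)).inf' (Finset.nonempty_range_iff.2
    (Nat.succ_ne_zero k)) θ with hΘ
  have hΘle : ∀ k, Θ k ≤ θ k := fun k =>
    Finset.inf'_le _ (Finset.mem_range.2 (Nat.lt_succ_self k))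
  have hΘpos : ∀ k, 0 < Θ k := fun k => (Finset.lt_inf'_iff _).2 fun j _ => hθ j
  have hΘanti : ∀ k, Θ (k + 1) ≤ Θ k := fun k =>
    (Finset.le_inf'_iff _ _).2 fun j hj =>
      Finset.inf'_le _ (Finset.mem_range.2 ((Finset.mem_range.1 hj).trans (Nat.lt_succ_self _)))
  -- compact containers for meshes in `[Θ (k+1), δ₀]`
  have hC : ∀ k, ∃ C : Set (CurveClass ℂ), IsCompact C ∧ ∀ δ ∈ Set.Icc (Θ (k + 1)) δ₀,
      ∀ u v : Site 2, u ≠ v → ∀ γ : DomainSAW D.carrier δ u v, γ.curve ∈ C := fun k =>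
    exists_isCompact_forall_curve_mem_zd D.isBounded (hΘpos (k + 1))
  choose C hCc hCmem using hC
  set η : ℕ → ℝ := fun k => 1 / ((k : ℝ) + 1) with hη
  have hηpos : ∀ k, 0 < η k := fun k => by positivity
  set A : ℕ → Set (CurveClass ℂ) := fun k => Metric.cthickening (η k) (K k) ∪ C k with hA
  set Kf : Set (CurveClass ℂ) := ⋂ k, A k with hKf
  have hKf_closed : IsClosed Kf :=
    isClosed_iInter fun k => Metric.isClosed_cthickening.union (hCc k).isClosed
  have hKf_tb : TotallyBounded Kf := by
    refine Metric.totallyBounded_iff.2 fun r hr => ?_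
    obtain ⟨k, hk⟩ := exists_nat_gt (3 / r)
    have hηk : 3 * η k < r := by
      have h3 : 3 < r * k := by rwa [div_lt_iff₀ hr, mul_comm] at hk
      have hk0 : (0 : ℝ) < k := by
        by_contra h0
        have : (k : ℝ) ≤ 0 := not_lt.1 h0
        nlinarith
      show 3 * (1 / ((k : ℝ) + 1)) < r
      rw [mul_one_div, div_lt_iff₀ (by positivity)]
      nlinarith
    obtain ⟨t, htfin, htcov⟩ :=
      Metric.totallyBounded_iff.1 ((hKc k).union (hCc k)).totallyBounded (η k) (hηpos k)
    refine ⟨t, htfin, fun x hx => ?_⟩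
    have hxA : x ∈ A k := Set.mem_iInter.1 hx k
    rcases hxA with hx1 | hx2
    · have hx1' : x ∈ Metric.thickening (2 * η k) (K k) :=
        Metric.cthickening_subset_thickening' (by linarith [hηpos k]) (by linarith [hηpos k]) _ hx1
      obtain ⟨z, hz, hxz⟩ := Metric.mem_thickening_iff.1 hx1'
      obtain ⟨y, hy, hzy⟩ := Set.mem_iUnion₂.1 (htcov (Or.inl hz))
      refine Set.mem_iUnion₂.2 ⟨y, hy, ?_⟩
      rw [Metric.mem_ball] at hzy ⊢
      calc dist x y ≤ dist x z + dist z y := dist_triangle _ _ _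
        _ < 2 * η k + η k := add_lt_add hxz hzy
        _ = 3 * η k := by ring
        _ < r := hηk
    · obtain ⟨y, hy, hxy⟩ := Set.mem_iUnion₂.1 (htcov (Or.inr hx2))
      refine Set.mem_iUnion₂.2 ⟨y, hy, ?_⟩
      rw [Metric.mem_ball] at hxy ⊢
      have : η k < r := by linarith [hηpos k]
      exact hxy.trans this
  have hKf_compact : IsCompact Kf :=
    isCompact_iff_totallyBounded_isComplete.2 ⟨hKf_tb, hKf_closed.isComplete⟩
  refine ⟨Kf, hKf_compact, ?_⟩
  rintro ν ⟨δ, hδ, rfl⟩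
  rw [Measure.map_apply (DomainSAW.measurable_of_top _) hKf_closed.isOpen_compl.measurableSet]
  have hpre : (fun γ : DomainSAW D.carrier δ (a δ) (b δ) => γ.curve) ⁻¹' Kfᶜ =
      ⋃ k, (fun γ : DomainSAW D.carrier δ (a δ) (b δ) => γ.curve) ⁻¹' (A k)ᶜ := by
    simp only [hKf, Set.compl_iInter, Set.preimage_iUnion]
  rw [hpre]
  refine (measure_iUnion_le _).trans ?_
  have hbound : ∀ k, law D.carrier δ (a δ) (b δ)
      ((fun γ : DomainSAW D.carrier δ (a δ) (b δ) => γ.curve) ⁻¹' (A k)ᶜ) ≤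
        ENNReal.ofReal (e / 2 / 2 ^ k) := by
    intro k
    rcases lt_or_ge δ (Θ (k + 1)) with hlt | hle
    · have hδk : δ ∈ Set.Ioo 0 (θ k) := ⟨hδ.1, hlt.trans_le ((hΘanti k).trans (hΘle k))⟩
      refine (measure_mono ?_).trans (hKθ k δ hδk).2
      refine Set.preimage_mono (Set.compl_subset_compl.2 ?_)
      exact (Metric.thickening_subset_cthickening _ _).trans Set.subset_union_left
    · have hne : a δ ≠ b δ := (hgood' δ hδ).2
      have hempty : (fun γ : DomainSAW D.carrier δ (a δ) (b δ) => γ.curve) ⁻¹' (A k)ᶜ = ∅ :=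
        Set.eq_empty_of_forall_notMem fun γ hγ => hγ (Or.inr (hCmem k δ ⟨hle, hδ.2⟩ _ _ hne γ))
      rw [hempty, measure_empty]
      exact bot_le
  calc ∑' k, law D.carrier δ (a δ) (b δ)
          ((fun γ : DomainSAW D.carrier δ (a δ) (b δ) => γ.curve) ⁻¹' (A k)ᶜ)
        ≤ ∑' k, ENNReal.ofReal (e / 2 / 2 ^ k) := ENNReal.tsum_le_tsum hbound
    _ = ENNReal.ofReal (∑' k, e / 2 / 2 ^ k) :=
        (ENNReal.ofReal_tsum_of_nonneg (fun k => by positivity) (summable_geometric_two' e)).symm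
    _ = ENNReal.ofReal e := by rw [tsum_geometric_two' e]
    _ = ε := ENNReal.ofReal_toReal hεtop

/-- Filter form: convergence in law to SLE_κ of the critical `δℤ²` SAW makes the curve classes
tight along the mesh (`IsTightAlongMesh`). [folklore] -/
theorem isTightAlongMesh_of_convergesInLawToSLE_zd (hab : IsEndpointApprox D a b)
    (h : ConvergesInLawToSLE κ D (fun δ (γ : DomainSAW D.carrier δ (a δ) (b δ)) => γ.curve)
      (fun δ => law D.carrier δ (a δ) (b δ))) :
    IsTightAlongMesh (fun δ (γ : DomainSAW D.carrier δ (a δ) (b δ)) => γ.curve)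
      (fun δ => law D.carrier δ (a δ) (b δ)) := by
  obtain ⟨δ₀, hδ₀, hT⟩ := exists_isTightMeasureSet_image_of_convergesInLawToSLE hab h
  exact isTightAlongMesh_of_isTightMeasureSet_image
    (Eventually.of_forall fun δ => (DomainSAW.measurable_of_top _).aemeasurable) hδ₀ hT

end Necessity

/-! ### §6.3 Corollaries for the route: the split `EventualTight ∧ SubseqIdentification` is exact -/

section Route

open Summit.CriticalPhenomena.SAWScalingLimit.Theses.SAWRenewalTightness

/-- **`SAWScalingLimit → EventualTight`**: the route's TARGET item (stmt-CriticalPhenomena-1372) is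
a CONSEQUENCE of the conjunct — a refutation of eventual tightness would refute the
Lawler–Schramm–Werner conjecture as typed (every SAW route), exactly as for the crux
(`subseqIdentification_of_sawScalingLimit`). [folklore] -/
theorem eventualTight_of_sawScalingLimit (h : SAW.SAWScalingLimit) : EventualTight :=
  fun D a b hab => exists_isTightMeasureSet_image_of_convergesInLawToSLE hab (h D a b hab)

/-- Contrapositive, for the negatives index. [folklore] -/
theorem not_sawScalingLimit_of_not_eventualTight (h : ¬ EventualTight) : ¬ SAW.SAWScalingLimit :=
  fun h' => h (eventualTight_of_sawScalingLimit h')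

/-- **THE ROUTE'S SPLIT IS LOSSLESS**: `SAWScalingLimit ↔ EventualTight ∧ SubseqIdentification`
(`→`: the two necessities; `←`: the route's deciding theorem `closes`, Prokhorov + uniqueness of
the SLE law, all proved in tree). So the crux `SubseqIdentification` is PRECISELY "the conjunct
minus tightness": conditional on `EventualTight` it is equivalent to the LSW conjecture as typed,
and unconditionally it is implied by it. [folklore] -/
theorem sawScalingLimit_iff_eventualTight_and_subseqIdentification :
    SAW.SAWScalingLimit ↔ EventualTight ∧ SubseqIdentification :=
  ⟨fun h => ⟨eventualTight_of_sawScalingLimit h, subseqIdentification_of_sawScalingLimit h⟩,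
    fun h => closes h.1 h.2⟩

/-- Crux-level reading: given `EventualTight`, the crux is EQUIVALENT to the conjunct. [folklore] -/
theorem subseqIdentification_iff_sawScalingLimit_of_eventualTight (hT : EventualTight) :
    SubseqIdentification ↔ SAW.SAWScalingLimit :=
  ⟨fun hI => closes hT hI, subseqIdentification_of_sawScalingLimit⟩

/-- … and given the crux, the target item is equivalent to the conjunct. [folklore] -/
theorem eventualTight_iff_sawScalingLimit_of_subseqIdentification (hI : SubseqIdentification) :
    EventualTight ↔ SAW.SAWScalingLimit :=
  ⟨fun hT => closes hT hI, eventualTight_of_sawScalingLimit⟩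

end Route



/-! ## §6b (cycle 2, after the line was PICKED) KS-regularity of limits is NECESSARY: `SubseqIdentification → LimitsDescribable`

The lead picked line `room-entropy-wright-fisher`, whose composition takes the shared route item
`SAWLaplacianWalk.LimitsDescribable` (stmt-CriticalPhenomena-4481) BY NAME as a hypothesis. It is a
COROLLARY of the crux (and of the conjunct), exactly as tightness is of the conjunct (§6): landed
separately as `Theorems/SubseqIdentification/Negative/DescribabilityNecessity.lean`. -/

section Describability

open UpperHalfPlane (upperHalfPlaneSet)
open Summit.CriticalPhenomena.SAWScalingLimit.Theses.SAWRenewalTightness (SubseqIdentification)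
open Summit.CriticalPhenomena.SAWScalingLimit.Theses.SAWLaplacianWalk (LimitsDescribable)

/-- **Chordal SLE_κ laws are a.s. Loewner-describable through every chordal uniformizing map.**
[folklore] -/
theorem ae_isLoewnerDescribable_of_isSLELaw {κ : ℝ≥0} {D : DobrushinDomain}
    {ν : Measure (CurveClass ℂ)} (hν : IsSLELaw κ D ν)
    {φ' : ConformalEquiv upperHalfPlaneSet D.carrier} (hφ' : D.IsChordalUniformizing φ') :
    ∀ᵐ c ∂ν, IsLoewnerDescribable φ' c := by
  obtain ⟨Γ, ⟨hΓm, φ, hφ, hae⟩, rfl⟩ := hν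
  rw [ae_map_iff hΓm (measurableSet_setOf_isLoewnerDescribable hφ')]
  obtain ⟨r, hr, hEq⟩ := MarkedDomain.IsChordalUniformizing.exists_eq_trans_smul_of_disc
    JordanDomain.exists_continuousOn_extension_holds hφ hφ'
  -- the dilation factor as an element of `ℝ≥0`
  obtain ⟨rn, hrn0, hrn⟩ : ∃ rn : ℝ≥0, rn ≠ 0 ∧ (rn : ℝ) = r :=
    ⟨r.toNNReal, (Real.toNNReal_pos.2 hr).ne', Real.coe_toNNReal r hr.le⟩
  have hρ0 : rn⁻¹ ≠ 0 := inv_ne_zero hrn0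
  have hr2 : rn ^ 2 ≠ 0 := pow_ne_zero 2 hrn0
  filter_upwards [hae] with ω ⟨hgen, c, hΓω, hc⟩
  -- the time-rescaled, dilated trace `s ↦ r⁻¹ γ(r² s)` is generated by `s ↦ r⁻¹ W(r² s)`
  have hgen' := hgen.scale hρ0
  have hcomp := hc.comp_mul hr2
  have hdiv : ∀ s : ℝ≥0, s / rn⁻¹ ^ 2 = rn ^ 2 * s := fun s => by
    rw [div_eq_mul_inv, inv_pow, inv_inv, mul_comm]
  refine ⟨_, ⟨continuous_const.mul ((continuous_sleDriving κ ω).comp (continuous_id.div_const _)),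
    _, hgen', c.reparam _, by rw [hΓω, CurveClass.mk_reparam], fun s hs => ?_, hcomp.2⟩⟩
  -- compactified images: `φ'(r⁻¹ γ(r² ρ)) = φ(γ(r² ρ))`
  rw [hcomp.1 s hs, φ.boundaryExtension_eq_of_eqOn_smul_trans φ' hr hEq]
  beta_reduce
  rw [hdiv, Complex.real_smul, ← mul_assoc, ← hrn, ← Complex.ofReal_mul, NNReal.coe_inv,
    mul_inv_cancel₀ (NNReal.coe_ne_zero.2 hrn0), Complex.ofReal_one, one_mul]

/-- With the a.s. starting point: an SLE_κ law is a.s. carried by describable classes from `a`.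
[folklore] -/
theorem ae_isLoewnerDescribable_and_source_of_isSLELaw {κ : ℝ≥0} {D : DobrushinDomain}
    {ν : Measure (CurveClass ℂ)} (hν : IsSLELaw κ D ν)
    {φ' : ConformalEquiv upperHalfPlaneSet D.carrier} (hφ' : D.IsChordalUniformizing φ') :
    ∀ᵐ c ∂ν, IsLoewnerDescribable φ' c ∧ c.source = D.pt 0 := by
  filter_upwards [ae_isLoewnerDescribable_of_isSLELaw hν hφ',
    IsSLELaw.ae_endpoints JordanDomain.mapsTo_boundaryExtension_holds hν] with c h1 h2
  exact ⟨h1, h2.1⟩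

open Summit.CriticalPhenomena.SAWScalingLimit.Theses.SAWRenewalTightness (SubseqIdentification)
open Summit.CriticalPhenomena.SAWScalingLimit.Theses.SAWLaplacianWalk (LimitsDescribable)

/-- **Under the crux, subsequential limits are KS-regular** — literally the body of
`SAWLaplacianWalk.LimitsDescribable` (item stmt-CriticalPhenomena-4481, the named hypothesis of the
picked line `room-entropy-wright-fisher` and of every martingale line), derived from
`SubseqIdentification`: under the crux every probability subsequential limit is the SLE_{8/3} law,
which is a.s. describable through every chordal uniformizing map and starts at `a`. So the line
loses nothing by assuming stmt-4481: it is a COROLLARY of the line's own conclusion. (Stated with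
the body spelled out rather than by the name `LimitsDescribable`, so that this support lemma is not
read as a proof of item 4481; `example` below records that the two agree definitionally.) [folklore] -/
theorem ae_isLoewnerDescribable_of_subseqIdentification (h : SubseqIdentification)
    (D : DobrushinDomain) (a b : ℝ → Site 2) (hab : IsEndpointApprox D a b)
    (φ : ConformalEquiv upperHalfPlaneSet D.carrier) (hφ : D.IsChordalUniformizing φ)
    (ν : Measure (CurveClass ℂ)) (hν : IsProbabilityMeasure ν)
    (hsub : IsSubseqLimitLaw (fun δ (γ : DomainSAW D.carrier δ (a δ) (b δ)) => γ.curve)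
      (fun δ => law D.carrier δ (a δ) (b δ)) ν) :
    ∀ᵐ c ∂ν, IsLoewnerDescribable φ c ∧ c.source = D.pt 0 := by
  obtain ⟨s, hs, hlim⟩ := hsub
  exact ae_isLoewnerDescribable_and_source_of_isSLELaw (h D a b hab s ν hs hν hlim) hφ

example (h : SubseqIdentification) : LimitsDescribable :=
  ae_isLoewnerDescribable_of_subseqIdentification h

/-- **`SAWScalingLimit → LimitsDescribable`**: stmt-4481 is NECESSARY for the conjunct (via
`subseqIdentification_of_sawScalingLimit`). [folklore] -/
theorem limitsDescribable_of_sawScalingLimit (h : SAW.SAWScalingLimit) : LimitsDescribable :=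
  ae_isLoewnerDescribable_of_subseqIdentification (subseqIdentification_of_sawScalingLimit h)

/-- Contrapositive, for the negatives index: a refutation of stmt-4481 refutes the LSW conjecture
as typed (every SAW route). [folklore] -/
theorem not_sawScalingLimit_of_not_limitsDescribable (h : ¬ LimitsDescribable) :
    ¬ SAW.SAWScalingLimit :=
  fun h' => h (limitsDescribable_of_sawScalingLimit h')

/-- … and refutes the crux. [folklore] -/
theorem not_subseqIdentification_of_not_limitsDescribable (h : ¬ LimitsDescribable) :
    ¬ SubseqIdentification :=
  fun h' => h (ae_isLoewnerDescribable_of_subseqIdentification h')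


end Describability

/-! ## §7 (cycle 2) Near-misses: the two debts written out as statements (sorried ON PURPOSE, work file only)

Each `sorry` below is a theorem the crux NEEDS (§5, §5.4) and the tree LACKS; the docstring records
the obstruction. They are not used by anything else in this file. -/

section NearMisses

/-- **DEBT 1 — Zhan's reversibility of chordal SLE_{8/3}** in every Dobrushin domain:
`reverse_* P^{SLE(8/3)}_{(D;a,b)} = P^{SLE(8/3)}_{(D;b,a)}`. By §5.3 the crux proves this on every
domain carrying a subsequential SAW limit (all domains with an endpoint approximation, under
`EventualTight`), so a proof of the crux contains a proof of this theorem for those domains.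
STATUS: true (Zhan, Ann. Probab. 36 (2008) 1472–1494, `κ ∈ (0,4]`; for `κ = 8/3` also
Lawler–Schramm–Werner, JAMS 16 (2003), via the restriction characterisation `P_{5/8}`), NOT in the
tree (`ChordalReversibility.lean` only defines `ChordalFamily.IsReversible`; searched
`lean search "IsReversible|reversib"`: no PROVED law-level reversibility of CHORDAL SLE; the whole-plane two-sided
facts of `TwoSidedWholePlaneSLEReversibility.lean` are named facts about a different object). OBSTRUCTION to proving it
here: needs either the restriction characterisation of SLE_{8/3} as the boundary of the `5/8`
restriction measure together with the reversibility of restriction measures, or Zhan's coupling —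
both far beyond a disprover's cycle. [cite: Zhan2008Reversibility, main theorem] -/
theorem debt_sle_eightThirds_reversible (D : DobrushinDomain) {ν : Measure (CurveClass ℂ)}
    (hν : IsSLELaw ((8 : ℝ≥0) / 3) D ν) :
    IsSLELaw ((8 : ℝ≥0) / 3) D.swap (ν.map CurveClass.reverse) := by
  sorry

/-- **DEBT 2 — non-vacuity of the crux on ONE domain**: some Dobrushin domain carries a
subsequential scaling limit of the critical `ℤ²` SAW (equivalently, by Prokhorov both ways on the
Polish space `CurveClass ℂ`: for some endpoint approximation ONE mesh sequence `s → 0⁺` has tight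
laws). STATUS: OPEN. It follows from the companion item `EventualTight` (§5.4,
`hasSubseqLimit_unitDisc_of_eventualTight`), i.e. from an Aizenman–Burchard / Kemppainen–Smirnov
crossing bound for the critical SAW, which is proved on no lattice (KS 2017 §4 treats FK, percolation,
harmonic explorer, LERW — not SAW; on the hexagonal lattice only bridge decay is known). Without it the
crux cannot be tested on a single instance, and a proof of the crux "by vacuity" is not excluded by any
theorem in print (though absurd). OBSTRUCTION: = tightness, the content of route SAWRenewalTightness
itself. [folklore] -/
theorem debt_exists_subseqLimit :
    ∃ (D : DobrushinDomain) (a b : ℝ → Site 2) (s : ℕ → ℝ) (μ : Measure (CurveClass ℂ)),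
      IsEndpointApprox D a b ∧ Tendsto s atTop (𝓝[>] (0 : ℝ)) ∧ IsProbabilityMeasure μ ∧
      ∀ f : CurveClass ℂ →ᵇ ℝ, Tendsto (fun n => ∫ γ, f γ.curve
        ∂(law D.carrier (s n) (a (s n)) (b (s n)))) atTop (𝓝 (∫ x, f x ∂μ)) := by
  sorry

end NearMisses

/-! ## §8 Verdict of cycle 2 and attack log -/

open Summit.CriticalPhenomena.SAWScalingLimit.Theses.SAWRenewalTightness in
/-- **VERDICT (cycle 2): NO KILL; two DEBTS and an exact STRUCTURE theorem added.** Formal content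
(all sorry-free): (i) the exact lattice reversibility of `SAW.law` and the REVERSIBILITY DEBT — the crux
alone proves Zhan's reversibility of chordal SLE_{8/3} on every domain carrying a subsequential SAW
limit (§5.3), on all domains with an endpoint approximation under `EventualTight` (§5.4); (ii) Prokhorov
non-vacuity: the hypotheses of the crux are satisfiable on `D` as soon as the laws are tight along the
mesh, in particular under `EventualTight` (unit disc instance); (iii) TIGHTNESS IS NECESSARY on `ℤ²`:
`SAWScalingLimit → EventualTight` (set form with a fixed `δ₀`, via compact containers of lattice
polylines), whence `SAWScalingLimit ↔ EventualTight ∧ SubseqIdentification` — the route's split of the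
conjunct is LOSSLESS and the crux is exactly "the conjunct minus tightness"; (iv) (§6b, after the
lead picked `room-entropy-wright-fisher`) the line's named hypothesis `LimitsDescribable` (stmt-4481)
is NECESSARY for the crux: `¬ LimitsDescribable → ¬ SubseqIdentification`.

ATTACK LOG (cycle 2; cycle 1's log is `verdict_cycle1`):
8. *Symmetry consistency (reversal).* The only exact symmetry of the two-point SAW ensemble that is NOT
   built into `IsSLELaw` by conformal invariance is time reversal (`map_sawReverse_law`, every mesh,
   junk included). Passing it to the limit cannot contradict the crux because SLE_{8/3} IS reversible
   (Zhan 2008) — but the tree does not know this, so the crux carries reversibility as a corollary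
   (`isSLELaw_swap_of_subseqIdentification`): a proof of the crux is at least as hard as a proof of
   SLE_{8/3} reversibility restricted to domains with limits. Had the in-tree SLE law been a
   non-reversible artefact, §5.3 + `EventualTight` would have REFUTED the crux; it is the honest law
   (`IsSLECurve`: conformal image of the Loewner trace of `√κ B`, Rohde–Schramm inputs discharged).
   Of the other lattice symmetries, the rotations of `D₄` and the scalings `δ ↦ λδ` with `Ω ↦ λΩ`
   are absorbed by the conformal invariance built into `IsSLELaw`; the REFLECTIONS of `D₄` are
   anti-conformal and need the reflection symmetry `√κB ↦ -√κB` of the driving process, which the tree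
   HAS at trace level (`SLERealAvoidance`: `IdentDistrib (sleTrace κ) (fun ω t ↦ -conj (sleTrace κ ω t))`),
   so a law-level `IsSLELaw κ D μ → IsSLELaw κ (D.image conj …) (conj_* μ)` is dischargeable (not done:
   no information for provers). Non-lattice rotations/translations are the open universality.
9. *κ-rigidity remark (not formalised).* At the lattice level the two-point law has the exact domain
   restriction property `P_{Ω'} = P_Ω( · | γ ⊂ Ω'_δ)` whenever `Ω'_δ ⊆ Ω_δ` componentwise; in the limit
   this is the LSW restriction property, which among SLE_κ holds only at `κ = 8/3` (LSW 2003). So the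
   variant of the crux with any `κ ≠ 8/3` is false modulo tightness + a portmanteau argument for the
   (non-continuity) event `{γ ⊂ D'}` — the classical reason for `8/3`; the largest-component convention
   (`meshDomain`: union of ALL maximal components) makes even the lattice identity conditional on
   `Ω'_δ ⊆ Ω_δ`, which fails for nested domains whose main rooms differ. Left to the restriction route.
10. *Non-vacuity.* No Dobrushin domain is known to carry a subsequential limit (§7 `debt_exists_subseqLimit`,
   = one tight mesh sequence, open). The crux is therefore untestable on any instance today; it is
   non-vacuous exactly where (a sequential weakening of) `EventualTight` holds (§5.4).
11. *Lattice effects in print.* Kennedy–Lawler, "Lattice effects in the scaling limit of the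
   two-dimensional self-avoiding walk", Contemp. Math. 601 (2013), arXiv:1109.3091, §2 (read: p.7 of the
   arXiv text): the persistent lattice correction `l(θ)` multiplies the boundary DENSITY of the endpoint
   of radial/boundary ensembles and depends on the angle of `∂D` against the lattice; for the two-point
   law normalised to a probability measure with FIXED endpoints `a_δ, b_δ` (our `SAW.law`) the factor
   cancels — no conflict with the crux. Kennedy, PRL 88 (2002) 130601, arXiv:math/0112246 (read: pp.3–4):
   Monte Carlo on the SQUARE lattice half-plane SAW agrees with two exact SLE_{8/3} distributions to
   within 1% of scale ("the agreement … is excellent") — numerical support for `κ = 8/3` on `ℤ²`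
   specifically (embedding `ℤ² ⊂ ℂ` un-sheared). [cycle-1 citations now verified from the texts.]
12. *Boundary pathologies (remark for provers).* `meshGraph` admits an edge as soon as the closed segment
   lies in `closure Ω`; for Jordan curves of positive area (Osgood) containing lattice segments, walks of
   `Ω_δ` may run inside `∂Ω`. No computable limit arises, so no kill; but proofs must not assume edges
   lie in `Ω`. Interior (non-boundary-vertex) approximants `a_δ` are allowed by `IsEndpointApprox`, so
   the crux is formally STRONGER than LSW's boundary-to-boundary phrasing; prime-end theory for Jordan
   domains (Pommerenke Thm 2.6, in tree as `JordanDomain.exists_continuousOn_extension_holds`) is what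
   makes Euclidean convergence `δ·a_δ → a` the right hypothesis (all interior approaches to `a` are one
   prime end) — a non-Jordan carrier (slit) would break this, but cannot be typed as a `DobrushinDomain`.
NEXT REGIMES (cycle 3+): attack the lead's stubs once a line is PICKED (none yet: four crux ideas
triaged r1 — two-point-pivot-rigidity, brownian-touch-squared-cauchy, room-entropy-wright-fisher pass;
boundary-area-law merged); port §6 to the filter form used by sibling routes if asked; formalise the
lattice restriction identity of item 9 for nested domains with `Ω'_δ ⊆ Ω_δ`. [folklore] -/
theorem verdict_cycle2 :
    (∀ (Ω : Set ℂ) (δ : ℝ) (a b : Site 2), (law Ω δ a b).map sawReverse = law Ω δ b a) ∧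
    (SubseqIdentification → ∀ (D : DobrushinDomain),
      (∃ (a b : ℝ → Site 2) (s : ℕ → ℝ) (μ : Measure (CurveClass ℂ)), IsEndpointApprox D a b ∧
        Tendsto s atTop (𝓝[>] (0 : ℝ)) ∧ IsProbabilityMeasure μ ∧
        (∀ f : CurveClass ℂ →ᵇ ℝ, Tendsto (fun n => ∫ γ, f γ.curve
          ∂(law D.carrier (s n) (a (s n)) (b (s n)))) atTop (𝓝 (∫ x, f x ∂μ)))) →
      ∀ ν : Measure (CurveClass ℂ), IsSLELaw ((8 : ℝ≥0) / 3) D ν →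
        IsSLELaw ((8 : ℝ≥0) / 3) D.swap (ν.map CurveClass.reverse)) ∧
    (EventualTight → SubseqIdentification → ∀ (D : DobrushinDomain) (a b : ℝ → Site 2),
      IsEndpointApprox D a b → ∀ ν : Measure (CurveClass ℂ), IsSLELaw ((8 : ℝ≥0) / 3) D ν →
        IsSLELaw ((8 : ℝ≥0) / 3) D.swap (ν.map CurveClass.reverse)) ∧
    (SAW.SAWScalingLimit → EventualTight) ∧
    (SAW.SAWScalingLimit ↔ EventualTight ∧ SubseqIdentification) ∧
    (¬ Summit.CriticalPhenomena.SAWScalingLimit.Theses.SAWLaplacianWalk.LimitsDescribable →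
      ¬ SubseqIdentification) :=
  ⟨fun _ _ _ _ => map_sawReverse_law,
    fun h _ hD _ hν => isSLELaw_swap_of_subseqIdentification h hD hν,
    fun hT h _ _ _ hab _ hν => isSLELaw_swap_of_eventualTight_of_subseqIdentification hT h hab hν,
    eventualTight_of_sawScalingLimit, sawScalingLimit_iff_eventualTight_and_subseqIdentification,
    not_subseqIdentification_of_not_limitsDescribable⟩

end Summit.CriticalPhenomena.SAWScalingLimit.Cruxes.SubseqIdentification.Disproof
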